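import Literature.MathematicalPhysics.StatisticalMechanics.Theil2006SimplexCover
import HarnessLib

/-!
# Theil 2006, Appendix Proposition 4.8 (2): the rigidity estimate (61) of a discrete imbedding
of a defect-free disc — proved, without Proposition 4.1 (F. John)

Topic `Literature/MathematicalPhysics/StatisticalMechanics`; companion of `Theil2006.lean`
(F. Theil, *A proof of crystallization in two dimensions*, Comm. Math. Phys. **262** (2006)
209–236, accepted preprint of 26 Aug 2005, lit store `paper:url-69bff4ce1e30`), Appendix §4.2,
Proposition 4.8 (p. 21), assertion (2). Everything here is PROVED (no `sorry`, no named fact;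
D-0026); the `private def`s are plain definitions with bodies (the affine interpolation on a
triangle and its linear part, the graph norm of `A₂`, two bookkeeping predicates).

## Source, as printed (preprint pp. 21, 23)

Proposition 4.8: "There exist universal constants `K` and `α₀ > 0` such that the following
statement holds for all `0 < α < α₀`. Let `Ω ⊂ ℝ²` be a simply connected and bounded Lipschitz
domain and let `X ⊂ ℝ²` be a particle system which satisfies (13) and `Ω ∩ y(∂X) = ∅`. Then for
each Lipschitz domain `Ω′ ⊂ Ω` such that `dist(Ω′, ∂Ω) > 3 diam(Ω′)` there exists a discrete
imbedding `Φ : ω → A₂`, where `ω = y⁻¹(Ω′)`. Furthermore, the following assertions are true. […]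
(2) `Φ` satisfies the rigidity estimate
(61) `| |Φ(x) − Φ(x′)| / |y(x) − y(x′)| − 1 | ≤ K α` for all `x, x′ ∈ ω`."
Printed proof of (61) (p. 23): "Let `u : y(Ω₂) → ℝ²` be the continuous and piecewise affine
interpolation of `u(y(x)) = Φ(x)`, `x ∈ y⁻¹(Ω₂)`. Clearly `u ∈ W^{1,∞}(Ω₂)` and by Lemma 4.2
`‖∇u − SO(2)‖_{L∞(Ω₂)} ≤ Kα`. Now we apply Proposition 4.1 and obtain inequality (61)."
(Proposition 4.1 = F. John's `L∞` rigidity theorem, *Rotation and strain* (1961), for which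
the print itself adds "we outline the proof for the convenience of the reader", pp. 16–17.)

## What is proved, and how (our proof; the statement is the printed (61) on discs)

`Theil2006.IsDiscreteImbeddingOn.rigidity_ball` — **(61) for ANY discrete imbedding `Φ`
(Definition 2.4) of a patch `ω ⊇ y⁻¹(B(c, R₁))` with no defect in `B(c, R₁)`**, for all
`x, x′` with `y(x), y(x′) ∈ B(c, r)`, `(5/2)(r + 1) ≤ R₁`, in the two-sided form
`(1 − Kα)|y(x) − y(x′)| ≤ |Φ(x) − Φ(x′)| ≤ (1 + Kα)|y(x) − y(x′)|` (universal `K`, all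
`0 < α ≤ α₁`; finitely many particles, (13)); `rigidity_ball'` is the printed quotient form.
So, combined with `Theil2006ReferenceUniqueness.lean` ((60)) and
`Theil2006ReferenceSurjectivity.lean` ((62)), ALL THREE numbered assertions of Proposition 4.8
hold for every discrete imbedding of a defect-free disc patch; what remains of Proposition 4.8
is the bare EXISTENCE of such an imbedding (`exists_rigid_of_exists_imbedding` records the
reduction in the shape consumed downstream).

The proof is NOT the printed one — no Proposition 4.1, no Sobolev spaces, no simple
connectivity. UPPER bound: the straight segment `[y(x), y(x′)] ⊂ B(c, r)` is covered by the
closed triangles `conv y(T)`, `T ∈ 𝒯₁(y)` with vertices in `B(c, r + 2)` ((63),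
`Theil2006SimplexCover.lean`), which form an embedded simplicial complex (two of them meet in a
common face, `convexHull_inter_convexHull_subset_face`; a particle inside a closed triangle is
a vertex, `mem_of_mem_convexHull_triple`). On each triangle the affine interpolation `u_T` of
`y(v) ↦ Φ(v)` has gradient `G_T` with `|G_T| ≤ (1 − Kα)⁻¹` — Lemma 4.2 in an elementary
bi-Lipschitz form with explicit constants (`exists_simplexBiLipschitz`, `K = 15`; the labels
`Φ(T)` form a unit lattice triangle by Remark 2.5) — and the
`u_T` agree on common faces, so telescoping along the segment (a one-dimensional chain lemma
over a finite closed cover, `norm_sub_le_of_cover_Icc`) gives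
`|Φ(x′) − Φ(x)| ≤ (1 − Kα)⁻¹ |y(x′) − y(x)|`. LOWER bound: the same argument on the LABEL
side — the lattice segment `[Φ(x), Φ(x′)]` is covered by closed unit triangles of `A₂`
(`exists_latticeTriangle_mem_convexHull`), which again form an embedded complex (the tree's
planarity theorems applied to the perfect lattice `triPoint : ℤ² → A₂`, a defect-free
configuration, `defectSet_triPoint_eq_empty`), and every such triangle near the segment is
REALIZED: its vertices are labels of particles of `ω` forming an `𝒮`-triangle, by the
surjectivity (62) in the sharp form `realize_label` (a private copy of
`exists_eq_of_dist_lt_sharp` of `Theil2006ReferenceSurjectivity.lean` together with its graph-norm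
induction, kept in this file so that it elaborates independently of that module; each half of the
segment is realized from its own endpoint) and Remark 2.5 (`isShortRange_of_dist_eq_one`); the affine
maps `Φ(v) ↦ y(v)` have gradients `|F_T| ≤ 1 + Kα`, whence
`|y(x′) − y(x)| ≤ (1 + Kα)|Φ(x′) − Φ(x)|`. (A bond-path count alone would only give the
factor `2/√3`; the affine telescoping along straight segments is what yields `1 + Kα`.)
The radius bookkeeping `(5/2)(r + 1) ≤ R₁` (ours) is what the sharp (62) affords; it fits the
applications of Proposition 4.8 on pp. 23–24 (discs of radius `≥ 2`, defects `≥ 4r + 2` away).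
-/

noncomputable section

universe u

open scoped BigOperators
open Set Metric

namespace Literature.MathematicalPhysics.StatisticalMechanics

namespace Theil2006

/-! ### A one-dimensional chain lemma: Lipschitz bounds along a finite closed cover of `[s, t]` -/

section Chain

variable {E : Type*} [SeminormedAddCommGroup E] {ι : Type*}

/-- **Telescoping along a finite closed cover of an interval.** If `[s, t]` is covered by
finitely many closed sets `C i` and `‖g v − g u‖ ≤ L|v − u|` whenever `u, v` lie in a common
`C i`, then `‖g t − g s‖ ≤ L(t − s)`: with `b = max (C i ∩ [s, t])` for a member containing
`s`, the interval `[b, t]` is covered by the other members (closedness), and one inducts on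
their number. [folklore] -/
private theorem norm_sub_le_of_cover_Icc (C : ι → Set ℝ) (g : ℝ → E) (L : ℝ) :
    ∀ (𝒞 : Finset ι) (s t : ℝ), s ≤ t → (∀ i ∈ 𝒞, IsClosed (C i)) →
      (∀ i ∈ 𝒞, ∀ u ∈ C i, ∀ v ∈ C i, ‖g v - g u‖ ≤ L * |v - u|) →
      Icc s t ⊆ (⋃ i ∈ 𝒞, C i) → ‖g t - g s‖ ≤ L * (t - s) := by
  intro 𝒞
  classical
  induction 𝒞 using Finset.strongInduction with
  | H 𝒞 ih =>
    intro s t hst hcl hg hcov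
    obtain ⟨i, hi, hsi⟩ : ∃ i ∈ 𝒞, s ∈ C i := by
      simpa only [mem_iUnion, exists_prop] using hcov (left_mem_Icc.2 hst)
    set S : Set ℝ := C i ∩ Icc s t with hS
    have hSc : IsCompact S := isCompact_Icc.inter_left (hcl i hi)
    have hsS : s ∈ S := ⟨hsi, left_mem_Icc.2 hst⟩
    have hbdd : BddAbove S := hSc.bddAbove
    set b : ℝ := sSup S with hb
    have hbS : b ∈ S := hSc.sSup_mem ⟨s, hsS⟩
    have hsb : s ≤ b := le_csSup hbdd hsS
    have hbt : b ≤ t := hbS.2.2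
    have h1 : ‖g b - g s‖ ≤ L * (b - s) := by
      have := hg i hi s hsi b hbS.1
      rwa [abs_of_nonneg (sub_nonneg.2 hsb)] at this
    rcases eq_or_lt_of_le hbt with hbt' | hblt
    · rw [← hbt']
      exact h1.trans (by rw [hbt'])
    -- `[b, t]` is covered by the other members
    have hcov' : Icc b t ⊆ ⋃ j ∈ 𝒞.erase i, C j := by
      intro u hu
      have key : ∀ u, b < u → u ≤ t → u ∈ ⋃ j ∈ 𝒞.erase i, C j := by
        intro u hbu hut
        have hucov := hcov ⟨hsb.trans hbu.le, hut⟩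
        simp only [mem_iUnion, exists_prop] at hucov
        obtain ⟨j, hj, huj⟩ := hucov
        have hji : j ≠ i := by
          rintro rfl
          have : u ≤ b := le_csSup hbdd ⟨huj, hsb.trans hbu.le, hut⟩
          linarith
        exact mem_iUnion₂.2 ⟨j, Finset.mem_erase.2 ⟨hji, hj⟩, huj⟩
      rcases eq_or_lt_of_le hu.1 with hbu | hbu
      · -- `u = b`: the complement of the finite union is open
        rw [← hbu]
        by_contra hnot
        have hclosedU : IsClosed (⋃ j ∈ 𝒞.erase i, C j) :=
          isClosed_biUnion_finset fun j hj => hcl j (Finset.mem_of_mem_erase hj)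
        obtain ⟨ε, hε, hεball⟩ := Metric.isOpen_iff.1 hclosedU.isOpen_compl b hnot
        set u' : ℝ := min (b + ε / 2) t with hu'
        have hu'1 : b < u' := lt_min (by linarith) hblt
        have hu'2 : u' ≤ t := min_le_right _ _
        have hu'3 : u' ∈ ball b ε := by
          rw [mem_ball, Real.dist_eq, abs_of_pos (by linarith)]
          have := min_le_left (b + ε / 2) t
          linarith
        exact hεball hu'3 (key u' hu'1 hu'2)
      · exact key u hbu hu.2
    have h2 := ih (𝒞.erase i) (Finset.erase_ssubset hi) b t hbt
      (fun j hj => hcl j (Finset.mem_of_mem_erase hj))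
      (fun j hj => hg j (Finset.mem_of_mem_erase hj)) hcov'
    calc ‖g t - g s‖ = ‖(g t - g b) + (g b - g s)‖ := by rw [sub_add_sub_cancel]
      _ ≤ ‖g t - g b‖ + ‖g b - g s‖ := norm_add_le _ _
      _ ≤ L * (t - b) + L * (b - s) := add_le_add h2 h1
      _ = L * (t - s) := by ring

end Chain

/-! ### Plane algebra: `det₂`, Cramer's rule, the affine interpolation on a triangle -/

section Algebra

/-- `‖v‖² = v₀² + v₁²`. [folklore] -/
private theorem norm_sq_coords (v : Plane) : ‖v‖ ^ 2 = v 0 ^ 2 + v 1 ^ 2 := by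
  rw [EuclideanSpace.norm_sq_eq, Fin.sum_univ_two, Real.norm_eq_abs, Real.norm_eq_abs, sq_abs,
    sq_abs]

/-- `det` is additive in the first slot. [folklore] -/
private theorem det₂_add_left (u v w : Plane) : det₂ (u + v) w = det₂ u w + det₂ v w := by
  unfold det₂
  simp only [PiLp.add_apply]
  ring

/-- `det` is additive in the second slot. [folklore] -/
private theorem det₂_add_right (u v w : Plane) : det₂ u (v + w) = det₂ u v + det₂ u w := by
  unfold det₂
  simp only [PiLp.add_apply]
  ring

/-- `det` is homogeneous in the first slot. [folklore] -/
private theorem det₂_smul_left (c : ℝ) (u w : Plane) : det₂ (c • u) w = c * det₂ u w := by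
  unfold det₂
  simp only [PiLp.smul_apply, smul_eq_mul]
  ring

/-- `det` is homogeneous in the second slot. [folklore] -/
private theorem det₂_smul_right (c : ℝ) (u w : Plane) : det₂ u (c • w) = c * det₂ u w := by
  unfold det₂
  simp only [PiLp.smul_apply, smul_eq_mul]
  ring

/-- `det(u, u) = 0`. [folklore] -/
private theorem det₂_self (u : Plane) : det₂ u u = 0 := by
  unfold det₂; ring

/-- `det(u, s u + t v) = t det(u, v)`. [folklore] -/
private theorem det₂_smul_add_smul_right (u v : Plane) (s t : ℝ) :
    det₂ u (s • u + t • v) = t * det₂ u v := by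
  rw [det₂_add_right, det₂_smul_right, det₂_smul_right, det₂_self]; ring

/-- `det(s u + t v, v) = s det(u, v)`. [folklore] -/
private theorem det₂_smul_add_smul_left (u v : Plane) (s t : ℝ) :
    det₂ (s • u + t • v) v = s * det₂ u v := by
  rw [det₂_add_left, det₂_smul_left, det₂_smul_left, det₂_self]; ring

/-- Cramer's rule in the plane: `w = (det(w,v)/D) u + (det(u,w)/D) v`, `D = det(u,v) ≠ 0`.
[folklore] -/
private theorem cramer₂ (u v w : Plane) (hD : det₂ u v ≠ 0) :
    w = (det₂ w v / det₂ u v) • u + (det₂ u w / det₂ u v) • v := by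
  have key : det₂ u v • w = det₂ w v • u + det₂ u w • v := by
    ext i
    fin_cases i
    · simp only [PiLp.add_apply, PiLp.smul_apply, smul_eq_mul, det₂, Fin.zero_eta, Fin.isValue]
      ring
    · simp only [PiLp.add_apply, PiLp.smul_apply, smul_eq_mul, det₂, Fin.mk_one, Fin.isValue]
      ring
  calc w = (det₂ u v)⁻¹ • (det₂ u v • w) := by rw [smul_smul, inv_mul_cancel₀ hD, one_smul]
    _ = (det₂ w v / det₂ u v) • u + (det₂ u w / det₂ u v) • v := by
      rw [key, smul_add, smul_smul, smul_smul, div_eq_inv_mul, div_eq_inv_mul]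

/-- **The linear part of the affine interpolation on a triangle.** For base points
`A₀, A₁, A₂` and values `B₀, B₁, B₂`, the linear map sending `A_i − A₀ ↦ B_i − B₀` (`i = 1, 2`),
written by Cramer's rule in the basis `(A₁ − A₀, A₂ − A₀)` (meaningful when
`det(A₁ − A₀, A₂ − A₀) ≠ 0`): the gradient `∇u` of the print's piecewise affine
interpolation. [cite: Theil2006, §4.1 Lemma 4.2 («the gradient of the unique affine map u»,
preprint p. 17); §4.2 proof of (61) (p. 23)] -/
private def interpLin (A B : Fin 3 → Plane) : Plane →ₗ[ℝ] Plane where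
  toFun w := (det₂ w (A 2 - A 0) / det₂ (A 1 - A 0) (A 2 - A 0)) • (B 1 - B 0) +
    (det₂ (A 1 - A 0) w / det₂ (A 1 - A 0) (A 2 - A 0)) • (B 2 - B 0)
  map_add' w w' := by
    simp only [det₂_add_left, det₂_add_right, add_div, add_smul]
    abel
  map_smul' c w := by
    simp only [det₂_smul_left, det₂_smul_right, RingHom.id_apply, smul_add, smul_smul,
      mul_div_assoc]

/-- Unfolding the interpolation gradient. [folklore] -/
private theorem interpLin_apply (A B : Fin 3 → Plane) (w : Plane) :
    interpLin A B w = (det₂ w (A 2 - A 0) / det₂ (A 1 - A 0) (A 2 - A 0)) • (B 1 - B 0) +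
      (det₂ (A 1 - A 0) w / det₂ (A 1 - A 0) (A 2 - A 0)) • (B 2 - B 0) := rfl

/-- The interpolation gradient on the first edge vector. [cite: Theil2006, §4.1 Lemma 4.2 (preprint p. 17)] -/
private theorem interpLin_base₁ (A B : Fin 3 → Plane) (hD : det₂ (A 1 - A 0) (A 2 - A 0) ≠ 0) :
    interpLin A B (A 1 - A 0) = B 1 - B 0 := by
  rw [interpLin_apply, det₂_self, zero_div, zero_smul, add_zero, div_self hD, one_smul]

/-- The interpolation gradient on the second edge vector. [cite: Theil2006, §4.1 Lemma 4.2 (preprint p. 17)] -/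
private theorem interpLin_base₂ (A B : Fin 3 → Plane) (hD : det₂ (A 1 - A 0) (A 2 - A 0) ≠ 0) :
    interpLin A B (A 2 - A 0) = B 2 - B 0 := by
  rw [interpLin_apply, det₂_self, zero_div, zero_smul, zero_add, div_self hD, one_smul]

/-- The interpolation gradient on every edge vector from `A₀`. [cite: Theil2006, §4.1 Lemma 4.2 (preprint p. 17)] -/
private theorem interpLin_base (A B : Fin 3 → Plane) (hD : det₂ (A 1 - A 0) (A 2 - A 0) ≠ 0)
    (i : Fin 3) : interpLin A B (A i - A 0) = B i - B 0 := by
  fin_cases i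
  · simp
  · exact interpLin_base₁ A B hD
  · exact interpLin_base₂ A B hD

/-- The interpolation gradient on every edge vector. [cite: Theil2006, §4.1 Lemma 4.2 (preprint p. 17)] -/
private theorem interpLin_sub (A B : Fin 3 → Plane) (hD : det₂ (A 1 - A 0) (A 2 - A 0) ≠ 0)
    (i j : Fin 3) : interpLin A B (A j - A i) = B j - B i := by
  have h : A j - A i = (A j - A 0) - (A i - A 0) := by abel
  rw [h, map_sub, interpLin_base A B hD, interpLin_base A B hD]
  abel

/-- The two interpolation gradients of a pair of non-degenerate triangles are mutually inverse.
[cite: Theil2006, §4.1 Lemma 4.2 («F⁻¹», preprint p. 17)] -/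
private theorem interpLin_interpLin (A B : Fin 3 → Plane) (hA : det₂ (A 1 - A 0) (A 2 - A 0) ≠ 0)
    (hB : det₂ (B 1 - B 0) (B 2 - B 0) ≠ 0) (w : Plane) :
    interpLin B A (interpLin A B w) = w := by
  set s := det₂ w (A 2 - A 0) / det₂ (A 1 - A 0) (A 2 - A 0) with hs
  set t := det₂ (A 1 - A 0) w / det₂ (A 1 - A 0) (A 2 - A 0) with ht
  have h1 : interpLin A B w = s • (B 1 - B 0) + t • (B 2 - B 0) := rfl
  rw [h1, map_add, map_smul, map_smul, interpLin_base₁ B A hB, interpLin_base₂ B A hB]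
  exact (cramer₂ _ _ w hA).symm

/-- **The affine interpolation** `u` with `u(A_i) = B_i`: `u(ξ) = B₀ + ∇u (ξ − A₀)`.
[cite: Theil2006, §4.2 proof of Proposition 4.8 (61) («the continuous and piecewise affine
interpolation», preprint p. 23)] -/
private def interp (A B : Fin 3 → Plane) (ξ : Plane) : Plane := B 0 + interpLin A B (ξ - A 0)

/-- The interpolation takes the prescribed values at the vertices. [cite: Theil2006, §4.2 proof of (61) (preprint p. 23)] -/
private theorem interp_vertex (A B : Fin 3 → Plane) (hD : det₂ (A 1 - A 0) (A 2 - A 0) ≠ 0)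
    (i : Fin 3) : interp A B (A i) = B i := by
  rw [interp, interpLin_base A B hD]; abel

/-- The interpolation is affine along every edge: `u(A_i + s(A_j − A_i)) = B_i + s(B_j − B_i)`.
[cite: Theil2006, §4.2 proof of (61) (preprint p. 23)] -/
private theorem interp_edge (A B : Fin 3 → Plane) (hD : det₂ (A 1 - A 0) (A 2 - A 0) ≠ 0)
    (i j : Fin 3) (s : ℝ) : interp A B (A i + s • (A j - A i)) = B i + s • (B j - B i) := by
  rw [interp, show A i + s • (A j - A i) - A 0 = (A i - A 0) + s • (A j - A i) by abel, map_add,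
    map_smul, interpLin_base A B hD, interpLin_sub A B hD]
  abel

/-- Differences of interpolated values are gradients of differences. [cite: Theil2006, §4.2 proof of (61) (preprint p. 23)] -/
private theorem interp_sub (A B : Fin 3 → Plane) (ξ ξ' : Plane) :
    interp A B ξ - interp A B ξ' = interpLin A B (ξ - ξ') := by
  unfold interp
  rw [add_sub_add_left_eq_sub, ← map_sub]
  congr 1
  abel

/-- An equilateral triangle of side `1` has `det² = 3/4` (Lagrange's identity). [folklore] -/
private theorem det₂_sq_of_unit (P Q R : Plane) (hPQ : ‖Q - P‖ = 1) (hPR : ‖R - P‖ = 1)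
    (hQR : ‖R - Q‖ = 1) : det₂ (Q - P) (R - P) ^ 2 = 3 / 4 := by
  have h1 := norm_sq_coords (Q - P)
  have h2 := norm_sq_coords (R - P)
  have h3 := norm_sq_coords (R - Q)
  rw [hPQ] at h1
  rw [hPR] at h2
  rw [hQR] at h3
  have e : R - Q = (R - P) - (Q - P) := by abel
  rw [e] at h3
  simp only [PiLp.sub_apply] at h1 h2 h3 ⊢
  unfold det₂
  simp only [PiLp.sub_apply]
  nlinarith [h1, h2, h3]

end Algebra

/-! ### Lemma 4.2 per unit simplex of a discrete imbedding -/

section Triangle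

/-- Lemma 4.2 in bi-Lipschitz form, as a predicate
on the two constants (so that the explicit-constant lemmas below can be stated before the
constants are chosen). [cite: Theil2006, §4.1 Lemma 4.2 (50)–(51) (preprint p. 17)] -/
private def SimplexBiLipschitz (K α₀ : ℝ) : Prop :=
  ∀ (y η : Fin 3 → Plane) (F : Plane →ₗ[ℝ] Plane),
    0 ≤ det₂ (y 1 - y 0) (y 2 - y 0) * det₂ (η 1 - η 0) (η 2 - η 0) →
    (∀ i j : Fin 3, i ≠ j → ‖η i - η j‖ = 1) →
    (∀ i : Fin 3, F (η i - η 0) = y i - y 0) →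
    ∀ m : ℝ, m ≤ α₀ → (∀ i j : Fin 3, i ≠ j → |‖y i - y j‖ - 1| ≤ m) →
      ∀ w : Plane, (1 - K * m) * ‖w‖ ≤ ‖F w‖ ∧ ‖F w‖ ≤ (1 + K * m) * ‖w‖

/-- The coordinate inner product on `ℝ²` (local copy). [folklore] -/
private def ipr (u v : Plane) : ℝ := u 0 * v 0 + u 1 * v 1

/-- `‖u − v‖² = ‖u‖² − 2⟨u,v⟩ + ‖v‖²`. [folklore] -/
private theorem norm_sub_sq_ipr (u v : Plane) : ‖u - v‖ ^ 2 = ‖u‖ ^ 2 - 2 * ipr u v + ‖v‖ ^ 2 := by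
  rw [norm_sq_coords, norm_sq_coords, norm_sq_coords, ipr]
  simp only [PiLp.sub_apply]
  ring

/-- `‖s u + t v‖² = s²‖u‖² + 2 s t ⟨u,v⟩ + t²‖v‖²`. [folklore] -/
private theorem norm_smul_add_smul_sq (s t : ℝ) (u v : Plane) :
    ‖s • u + t • v‖ ^ 2 = s ^ 2 * ‖u‖ ^ 2 + 2 * s * t * ipr u v + t ^ 2 * ‖v‖ ^ 2 := by
  rw [norm_sq_coords, norm_sq_coords, norm_sq_coords, ipr]
  simp only [PiLp.add_apply, PiLp.smul_apply, smul_eq_mul]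
  ring

/-- Lagrange's identity `⟨u,v⟩² + det(u,v)² = ‖u‖²‖v‖²`. [folklore] -/
private theorem ipr_sq_add_det₂_sq (u v : Plane) : ipr u v ^ 2 + det₂ u v ^ 2 = ‖u‖ ^ 2 * ‖v‖ ^ 2 := by
  rw [norm_sq_coords, norm_sq_coords, ipr, det₂]
  ring

/-- If `|a − 1| ≤ m ≤ 1` and `a ≥ 0` then `|a² − 1| ≤ 3m`. [folklore] -/
private theorem sq_sub_one_bounds {a m : ℝ} (hm : m ≤ 1) (ha : 0 ≤ a) (h1 : -m ≤ a - 1)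
    (h2 : a - 1 ≤ m) : -(3 * m) ≤ a ^ 2 - 1 ∧ a ^ 2 - 1 ≤ 3 * m := by
  have hm0 : 0 ≤ m := by linarith
  constructor <;> nlinarith

set_option maxHeartbeats 400000 in
/-- **Lemma 4.2, the bi-Lipschitz content, with explicit constants `K = 15`, `α₀ = 1`.** The
linear map taking an exact unit lattice triangle to a triangle with sides in `[1 − m, 1 + m]`
distorts lengths by at most the factor `1 ± 15m`: in the basis `e₁, e₂` of the unit triangle
(`⟨e₁, e₂⟩ = ½`), `‖w‖² = s² + st + t²` for `w = s e₁ + t e₂`, while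
`‖F w‖² = s²‖u‖² + 2st⟨u, v⟩ + t²‖v‖²` with `‖u‖², ‖v‖² ∈ [(1 − m)², (1 + m)²]` and
`2⟨u, v⟩ = ‖u‖² + ‖v‖² − ‖u − v‖² ∈ [1 − 9m, 1 + 9m]`. (The print's (50) gives closeness of
`∇u` to a rotation; only this consequence is used for (61).)
[cite: Theil2006, §4.1 Lemma 4.2 (50)–(51) (preprint p. 17); our constants] -/
private theorem exists_simplexBiLipschitz :
    ∃ K α₀ : ℝ, 0 < K ∧ 0 < α₀ ∧ SimplexBiLipschitz K α₀ := by
  refine ⟨15, 1, by norm_num, by norm_num, fun y η F _ hη hF m hm hdef w => ?_⟩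
  have hm0 : 0 ≤ m := (abs_nonneg _).trans (hdef 0 1 (by decide))
  -- the unit triangle `e₁ = η₁ − η₀`, `e₂ = η₂ − η₀`
  obtain ⟨e₁, he₁⟩ : ∃ e₁ : Plane, e₁ = η 1 - η 0 := ⟨_, rfl⟩
  obtain ⟨e₂, he₂⟩ : ∃ e₂ : Plane, e₂ = η 2 - η 0 := ⟨_, rfl⟩
  have hn1 : ‖e₁‖ = 1 := by rw [he₁]; exact hη 1 0 (by decide)
  have hn2 : ‖e₂‖ = 1 := by rw [he₂]; exact hη 2 0 (by decide)
  have hn12 : ‖e₁ - e₂‖ = 1 := by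
    rw [he₁, he₂, sub_sub_sub_cancel_right]; exact hη 1 2 (by decide)
  have hip : ipr e₁ e₂ = 1 / 2 := by
    have := norm_sub_sq_ipr e₁ e₂
    rw [hn1, hn2, hn12] at this
    linarith
  have hdet : det₂ e₁ e₂ ≠ 0 := by
    intro h0
    have := ipr_sq_add_det₂_sq e₁ e₂
    rw [hip, h0, hn1, hn2] at this
    norm_num at this
  -- coordinates of `w` in the basis `e₁, e₂`
  obtain ⟨s, t, hw⟩ : ∃ s t : ℝ, w = s • e₁ + t • e₂ := ⟨_, _, cramer₂ e₁ e₂ w hdet⟩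
  -- the image triangle `u = y₁ − y₀`, `v = y₂ − y₀`
  obtain ⟨u, hu⟩ : ∃ u : Plane, u = y 1 - y 0 := ⟨_, rfl⟩
  obtain ⟨v, hv⟩ : ∃ v : Plane, v = y 2 - y 0 := ⟨_, rfl⟩
  have hF1 : F e₁ = u := by rw [he₁, hu]; exact hF 1
  have hF2 : F e₂ = v := by rw [he₂, hv]; exact hF 2
  have hFw : F w = s • u + t • v := by
    rw [hw, map_add, map_smul, map_smul, hF1, hF2]
  have hu1 := hdef 1 0 (by decide)
  have hv1 := hdef 2 0 (by decide)
  have huv1 := hdef 1 2 (by decide)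
  have huv : y 1 - y 2 = u - v := by rw [hu, hv, sub_sub_sub_cancel_right]
  rw [huv] at huv1
  rw [← hu] at hu1
  rw [← hv] at hv1
  rw [abs_le] at hu1 hv1 huv1
  have hw2 : ‖w‖ ^ 2 = s ^ 2 + s * t + t ^ 2 := by
    rw [hw, norm_smul_add_smul_sq, hn1, hn2, hip]; ring
  have hF2' : ‖F w‖ ^ 2 = s ^ 2 * ‖u‖ ^ 2 + 2 * s * t * ipr u v + t ^ 2 * ‖v‖ ^ 2 := by
    rw [hFw, norm_smul_add_smul_sq]
  have hipuv : 2 * ipr u v = ‖u‖ ^ 2 + ‖v‖ ^ 2 - ‖u - v‖ ^ 2 := by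
    have := norm_sub_sq_ipr u v; linarith
  -- bounds on the squared side lengths
  have hu0 : 0 ≤ ‖u‖ := norm_nonneg _
  have hv0 : 0 ≤ ‖v‖ := norm_nonneg _
  have huv0 : 0 ≤ ‖u - v‖ := norm_nonneg _
  obtain ⟨hu1, hu1'⟩ := hu1
  obtain ⟨hv1, hv1'⟩ := hv1
  obtain ⟨huv1, huv1'⟩ := huv1
  have eu := sq_sub_one_bounds hm hu0 hu1 hu1'
  have ev := sq_sub_one_bounds hm hv0 hv1 hv1'
  have euv := sq_sub_one_bounds hm huv0 huv1 huv1'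
  have eip : -(9 * m) ≤ 2 * ipr u v - 1 ∧ 2 * ipr u v - 1 ≤ 9 * m := by
    rw [hipuv]; constructor <;> linarith [eu.1, eu.2, ev.1, ev.2, euv.1, euv.2]
  -- `|‖F w‖² − ‖w‖²| ≤ 15 m ‖w‖²`
  have hst : s ^ 2 + t ^ 2 ≤ 2 * ‖w‖ ^ 2 := by rw [hw2]; nlinarith [sq_nonneg (s + t)]
  have hst1 : s * t ≤ ‖w‖ ^ 2 := by rw [hw2]; nlinarith [sq_nonneg (s + t)]
  have hst2 : -(s * t) ≤ ‖w‖ ^ 2 := by rw [hw2]; nlinarith [sq_nonneg (s - t)]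
  have e : ‖F w‖ ^ 2 - ‖w‖ ^ 2 =
      s ^ 2 * (‖u‖ ^ 2 - 1) + t ^ 2 * (‖v‖ ^ 2 - 1) + s * t * (2 * ipr u v - 1) := by
    rw [hF2', hw2]; ring
  have h1 : s ^ 2 * (‖u‖ ^ 2 - 1) ≤ s ^ 2 * (3 * m) :=
    mul_le_mul_of_nonneg_left eu.2 (sq_nonneg s)
  have h1' : -(s ^ 2 * (3 * m)) ≤ s ^ 2 * (‖u‖ ^ 2 - 1) := by
    have := mul_le_mul_of_nonneg_left eu.1 (sq_nonneg s); linarith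
  have h2 : t ^ 2 * (‖v‖ ^ 2 - 1) ≤ t ^ 2 * (3 * m) :=
    mul_le_mul_of_nonneg_left ev.2 (sq_nonneg t)
  have h2' : -(t ^ 2 * (3 * m)) ≤ t ^ 2 * (‖v‖ ^ 2 - 1) := by
    have := mul_le_mul_of_nonneg_left ev.1 (sq_nonneg t); linarith
  have h3 : |s * t * (2 * ipr u v - 1)| ≤ ‖w‖ ^ 2 * (9 * m) := by
    rw [abs_mul]
    exact mul_le_mul (abs_le.2 ⟨by linarith, hst1⟩) (abs_le.2 ⟨by linarith, eip.2⟩)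
      (abs_nonneg _) (sq_nonneg _)
  rw [abs_le] at h3
  have hst3 : 3 * m * (s ^ 2 + t ^ 2) ≤ 3 * m * (2 * ‖w‖ ^ 2) :=
    mul_le_mul_of_nonneg_left hst (by positivity)
  have hup2 : ‖F w‖ ^ 2 ≤ (1 + 15 * m) * ‖w‖ ^ 2 := by linarith
  have hlo2 : (1 - 15 * m) * ‖w‖ ^ 2 ≤ ‖F w‖ ^ 2 := by linarith
  have hW0 : 0 ≤ ‖w‖ := norm_nonneg _
  have hFW0 : 0 ≤ ‖F w‖ := norm_nonneg _
  have hW2 : 0 ≤ ‖w‖ ^ 2 := sq_nonneg _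
  constructor
  · -- lower bound
    by_cases hneg : 1 - 15 * m ≤ 0
    · exact (mul_nonpos_of_nonpos_of_nonneg hneg hW0).trans hFW0
    · rw [not_le] at hneg
      have hsq : (1 - 15 * m) ^ 2 ≤ 1 - 15 * m := by
        rw [sq]; exact mul_le_of_le_one_right hneg.le (by linarith)
      have h2 : ((1 - 15 * m) * ‖w‖) ^ 2 ≤ ‖F w‖ ^ 2 := by
        rw [mul_pow]
        exact (mul_le_mul_of_nonneg_right hsq hW2).trans hlo2
      have h0 : 0 ≤ (1 - 15 * m) * ‖w‖ := mul_nonneg hneg.le hW0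
      exact (pow_le_pow_iff_left₀ h0 hFW0 two_ne_zero).1 h2
  · -- upper bound
    have h15 : 0 ≤ 1 + 15 * m := by linarith
    have hsq : 1 + 15 * m ≤ (1 + 15 * m) ^ 2 := by
      rw [sq]; exact le_mul_of_one_le_right h15 (by linarith)
    have h2 : ‖F w‖ ^ 2 ≤ ((1 + 15 * m) * ‖w‖) ^ 2 := by
      rw [mul_pow]
      exact hup2.trans (mul_le_mul_of_nonneg_right hsq hW2)
    exact (pow_le_pow_iff_left₀ hFW0 (mul_nonneg h15 hW0) two_ne_zero).1 h2

variable {X : Type*} {α : ℝ} {y : X → Plane} {ω : Set X} {Φ : X → ℤ × ℤ}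

/-- The positions of an ordered triple of particles. [cite: Theil2006, §4.1 Lemma 4.2 («y_i», preprint p. 17)] -/
private def yTri (y : X → Plane) (a b c : X) : Fin 3 → Plane := ![y a, y b, y c]

/-- The labels of an ordered triple of particles, as points of `A₂`. [cite: Theil2006, §4.1 Lemma 4.2 («η_i», preprint p. 17)] -/
private def ηTri (Φ : X → ℤ × ℤ) (a b c : X) : Fin 3 → Plane :=
  ![triPoint (Φ a), triPoint (Φ b), triPoint (Φ c)]

/-- First enumerated position. [folklore] -/
private theorem yTri_zero (a b c : X) : yTri y a b c 0 = y a := rfl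

/-- Second enumerated position. [folklore] -/
private theorem yTri_one (a b c : X) : yTri y a b c 1 = y b := rfl

/-- Third enumerated position. [folklore] -/
private theorem yTri_two (a b c : X) : yTri y a b c 2 = y c := rfl

/-- First enumerated label. [folklore] -/
private theorem ηTri_zero (a b c : X) : ηTri Φ a b c 0 = triPoint (Φ a) := rfl

/-- Second enumerated label. [folklore] -/
private theorem ηTri_one (a b c : X) : ηTri Φ a b c 1 = triPoint (Φ b) := rfl

/-- Third enumerated label. [folklore] -/
private theorem ηTri_two (a b c : X) : ηTri Φ a b c 2 = triPoint (Φ c) := rfl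

/-- Each vertex of `{a, b, c}` is one of the three enumerated ones. [folklore] -/
private theorem exists_index_of_mem [DecidableEq X] {a b c v : X}
    (hv : v ∈ ({a, b, c} : Finset X)) :
    ∃ i : Fin 3, y v = yTri y a b c i ∧ triPoint (Φ v) = ηTri Φ a b c i := by
  simp only [Finset.mem_insert, Finset.mem_singleton] at hv
  rcases hv with rfl | rfl | rfl
  · exact ⟨0, rfl, rfl⟩
  · exact ⟨1, rfl, rfl⟩
  · exact ⟨2, rfl, rfl⟩

/-- A symmetric relation holding on the three pairs `(0,1), (0,2), (1,2)` holds on all pairs of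
distinct indices of `Fin 3`. [folklore] -/
private theorem fin3_pairwise {β : Type*} (P : Fin 3 → β) {R : β → β → Prop}
    (hsymm : ∀ u v, R u v → R v u) (h01 : R (P 0) (P 1)) (h02 : R (P 0) (P 2))
    (h12 : R (P 1) (P 2)) : ∀ i j : Fin 3, i ≠ j → R (P i) (P j) := by
  intro i j hij
  fin_cases i <;> fin_cases j
  · exact absurd rfl hij
  · exact h01
  · exact h02
  · exact hsymm _ _ h01
  · exact absurd rfl hij
  · exact h12
  · exact hsymm _ _ h02
  · exact hsymm _ _ h12
  · exact absurd rfl hij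

/-- An `𝒮`-triangle is non-degenerate (`det² ≥ (21/25)²`, `Theil2006SimplexCover`).
[cite: Theil2006, §2.3 before Definition 2.4 (preprint p. 7); our constant] -/
private theorem det₂_yTri_ne_zero (hα : 0 < α) (hα' : α ≤ 1 / 200) {a b c : X}
    (hab : IsShortRange α y a b) (hac : IsShortRange α y a c) (hbc : IsShortRange α y b c) :
    det₂ (yTri y a b c 1 - yTri y a b c 0) (yTri y a b c 2 - yTri y a b c 0) ≠ 0 := by
  intro h0
  have h := sq_le_det₂_sq_of_isShortRange hα hα' hab hac hbc
  rw [yTri_zero, yTri_one, yTri_two] at h0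
  rw [h0] at h
  norm_num at h

/-- The labels of an `𝒮`-triangle inside the patch of a discrete imbedding form a unit lattice
triangle (Remark 2.5). [cite: Theil2006, §2.3 Remark 2.5 (preprint p. 7)] -/
private theorem norm_ηTri_sub (hΦ : IsDiscreteImbeddingOn α y ω Φ) (hα1 : α < 1) {a b c : X}
    (ha : a ∈ ω) (hb : b ∈ ω) (hc : c ∈ ω)
    (hab : IsShortRange α y a b) (hac : IsShortRange α y a c) (hbc : IsShortRange α y b c) :
    ∀ i j : Fin 3, i ≠ j → ‖ηTri Φ a b c i - ηTri Φ a b c j‖ = 1 := by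
  have dab := hΦ.dist_eq_one hα1 ha hb hab
  have dac := hΦ.dist_eq_one hα1 ha hc hac
  have dbc := hΦ.dist_eq_one hα1 hb hc hbc
  rw [dist_eq_norm] at dab dac dbc
  exact fin3_pairwise (ηTri Φ a b c) (R := fun u v => ‖u - v‖ = 1)
    (fun u v h => by rwa [norm_sub_rev]) dab dac dbc

/-- … hence are non-degenerate: `det² = 3/4`. [cite: Theil2006, §2.3 Remark 2.5 (preprint p. 7)] -/
private theorem det₂_ηTri_ne_zero (hΦ : IsDiscreteImbeddingOn α y ω Φ) (hα1 : α < 1) {a b c : X}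
    (ha : a ∈ ω) (hb : b ∈ ω) (hc : c ∈ ω)
    (hab : IsShortRange α y a b) (hac : IsShortRange α y a c) (hbc : IsShortRange α y b c) :
    det₂ (ηTri Φ a b c 1 - ηTri Φ a b c 0) (ηTri Φ a b c 2 - ηTri Φ a b c 0) ≠ 0 := by
  have h := norm_ηTri_sub hΦ hα1 ha hb hc hab hac hbc
  intro h0
  have h34 := det₂_sq_of_unit (ηTri Φ a b c 0) (ηTri Φ a b c 1) (ηTri Φ a b c 2)
    (h 1 0 (by decide)) (h 2 0 (by decide)) (h 2 1 (by decide))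
  rw [h0] at h34
  norm_num at h34

/-- The bond-length deficits of an `𝒮`-triangle are `≤ α`. [cite: Theil2006, §2.1 (definition of 𝒮(y), preprint p. 4)] -/
private theorem deficit_yTri {a b c : X}
    (hab : IsShortRange α y a b) (hac : IsShortRange α y a c) (hbc : IsShortRange α y b c) :
    ∀ i j : Fin 3, i ≠ j → |‖yTri y a b c i - yTri y a b c j‖ - 1| ≤ α := by
  have dab : |‖y a - y b‖ - 1| ≤ α := by rw [← dist_eq_norm]; exact hab
  have dac : |‖y a - y c‖ - 1| ≤ α := by rw [← dist_eq_norm]; exact hac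
  have dbc : |‖y b - y c‖ - 1| ≤ α := by rw [← dist_eq_norm]; exact hbc
  exact fin3_pairwise (yTri y a b c) (R := fun u v => |‖u - v‖ - 1| ≤ α)
    (fun u v h => by rwa [norm_sub_rev]) dab dac dbc

/-- **Lemma 4.2 for a unit simplex of a discrete imbedding, label-to-position direction**: the
affine gradient `F_T` with `F_T(Φ(v) − Φ(v′)) = y(v) − y(v′)` is `(1 ± Kα)`-bi-Lipschitz
(orientation by (20), unit labels by Remark 2.5, deficits `≤ α`).
[cite: Theil2006, §4.1 Lemma 4.2 (50) (preprint p. 17); §4.2 proof of (61) (p. 23)] -/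
private theorem triangle_bilipschitz {K α₀ : ℝ} (hBL : SimplexBiLipschitz K α₀)
    (hΦ : IsDiscreteImbeddingOn α y ω Φ) (hα1 : α < 1) (hαα₀ : α ≤ α₀) {a b c : X}
    (ha : a ∈ ω) (hb : b ∈ ω) (hc : c ∈ ω)
    (hab : IsShortRange α y a b) (hac : IsShortRange α y a c) (hbc : IsShortRange α y b c)
    (w : Plane) :
    (1 - K * α) * ‖w‖ ≤ ‖interpLin (ηTri Φ a b c) (yTri y a b c) w‖ ∧
      ‖interpLin (ηTri Φ a b c) (yTri y a b c) w‖ ≤ (1 + K * α) * ‖w‖ := by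
  refine hBL (yTri y a b c) (ηTri Φ a b c) _ ?_ (norm_ηTri_sub hΦ hα1 ha hb hc hab hac hbc)
    (interpLin_base _ _ (det₂_ηTri_ne_zero hΦ hα1 ha hb hc hab hac hbc)) α hαα₀
    (deficit_yTri hab hac hbc) w
  simp only [yTri_zero, yTri_one, yTri_two, ηTri_zero, ηTri_one, ηTri_two]
  exact hΦ.orientationOn ha hb hc hab hac hbc

/-- **Lemma 4.2, position-to-label direction**: the gradient `G_T` of the interpolation
`u(y(v)) = Φ(v)` satisfies `(1 − Kα)|G_T v| ≤ |v|` (`G_T = F_T⁻¹`).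
[cite: Theil2006, §4.1 Lemma 4.2 (51) (preprint p. 17); §4.2 proof of (61) (p. 23)] -/
private theorem triangle_inv_lipschitz {K α₀ : ℝ} (hBL : SimplexBiLipschitz K α₀)
    (hΦ : IsDiscreteImbeddingOn α y ω Φ) (hα : 0 < α) (hα' : α ≤ 1 / 200) (hαα₀ : α ≤ α₀)
    {a b c : X} (ha : a ∈ ω) (hb : b ∈ ω) (hc : c ∈ ω)
    (hab : IsShortRange α y a b) (hac : IsShortRange α y a c) (hbc : IsShortRange α y b c)
    (v : Plane) :
    (1 - K * α) * ‖interpLin (yTri y a b c) (ηTri Φ a b c) v‖ ≤ ‖v‖ := by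
  have hα1 : α < 1 := by linarith
  have h := (triangle_bilipschitz hBL hΦ hα1 hαα₀ ha hb hc hab hac hbc
    (interpLin (yTri y a b c) (ηTri Φ a b c) v)).1
  rwa [interpLin_interpLin _ _ (det₂_yTri_ne_zero hα hα' hab hac hbc)
    (det₂_ηTri_ne_zero hΦ hα1 ha hb hc hab hac hbc)] at h

end Triangle

/-! ### The upper bound: telescoping along `[y(x), y(x′)]` through the unit simplices (63) -/

section Upper

variable {X : Type*} {α : ℝ} {y : X → Plane} {ω : Set X} {Φ : X → ℤ × ℤ}

/-- `y({a, b, c}) = {y(a), y(b), y(c)}`. [folklore] -/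
private theorem image_coe_triple [DecidableEq X] (f : X → Plane) (a b c : X) :
    f '' ↑({a, b, c} : Finset X) = {f a, f b, f c} := by
  rw [Finset.coe_insert, Finset.coe_insert, Finset.coe_singleton, image_insert_eq,
    image_insert_eq, image_singleton]

/-- **(61), upper half, for every discrete imbedding of a defect-free disc** (explicit
constants): if `Φ` is a discrete imbedding of `ω ⊇ y⁻¹(B(c, R))`, no defect lies in `B(c, R)`,
`r + 2 ≤ R`, then `|Φ(x) − Φ(x′)| ≤ (1 − Kα)⁻¹ |y(x) − y(x′)|` for `y(x), y(x′) ∈ B(c, r)`.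
Proof: telescoping of the affine interpolations `u_T` along the segment `[y(x), y(x′)]` through
the closed triangles of (63), which agree on common faces.
[cite: Theil2006, §4.2 Proposition 4.8 (2) (61) and its proof via (63) and Lemma 4.2
(preprint pp. 21, 23); our proof, without Proposition 4.1] -/
private theorem dist_triPoint_le_aux [Finite X] {K α₀ : ℝ} (hBL : SimplexBiLipschitz K α₀)
    (hα : 0 < α) (hα' : α ≤ 1 / 200) (hαα₀ : α ≤ α₀)
    (hKα : K * α < 1) (hsep : ∀ x x' : X, x ≠ x' → 1 - α < dist (y x) (y x'))
    {c : Plane} {r R : ℝ} (hrR : r + 2 ≤ R) (hdef : ∀ b ∈ defectSet α y, R ≤ dist (y b) c)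
    (hloc : ∀ ⦃a b c' : X⦄, y a ∈ ball c R → y b ∈ ball c R → y c' ∈ ball c R →
      IsShortRange α y a b → IsShortRange α y a c' → IsShortRange α y b c' →
      ∃ ω' : Set X, IsDiscreteImbeddingOn α y ω' Φ ∧ a ∈ ω' ∧ b ∈ ω' ∧ c' ∈ ω')
    {x x' : X} (hx : y x ∈ ball c r) (hx' : y x' ∈ ball c r) :
    dist (triPoint (Φ x)) (triPoint (Φ x')) ≤ (1 - K * α)⁻¹ * dist (y x) (y x') := by
  classical
  haveI := Fintype.ofFinite X
  have hα1 : α < 1 := by linarith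
  have h1K : 0 < 1 - K * α := by linarith
  -- the cover triangles
  set 𝒯 : Finset (Finset X) :=
    Finset.univ.filter (fun T => IsEquilateralSimplex α y 1 T ∧ ∀ z ∈ T, y z ∈ ball c R) with h𝒯
  have hmem𝒯 : ∀ {T : Finset X}, T ∈ 𝒯 ↔ IsEquilateralSimplex α y 1 T ∧ ∀ z ∈ T, y z ∈ ball c R := by
    intro T
    simp only [h𝒯, Finset.mem_filter, Finset.mem_univ, true_and]
  have hcov : ∀ ξ ∈ ball c r, ∃ T ∈ 𝒯, ξ ∈ convexHull ℝ (y '' ↑T) := fun ξ hξ => by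
    obtain ⟨T, hT, hTR, hξT⟩ :=
      exists_simplex_mem_convexHull_of_mem_ball hα hα' hsep hrR hdef hx hξ
    exact ⟨T, hmem𝒯.2 ⟨hT, hTR⟩, hξT⟩
  have hTball : ∀ T ∈ 𝒯, ∀ z ∈ T, y z ∈ ball c R := fun T hT z hz => (hmem𝒯.1 hT).2 z hz
  have hTgood : ∀ T ∈ 𝒯, ∀ z ∈ T, z ∉ defectSet α y := fun T hT z hz hzd => by
    have h1 := hdef z hzd
    have h2 := mem_ball.1 ((hmem𝒯.1 hT).2 z hz)
    linarith
  have hTsr : ∀ T ∈ 𝒯, ∀ p ∈ T, ∀ q ∈ T, p ≠ q → IsShortRange α y p q := fun T hT =>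
    (isEquilateralSimplex_one_iff.1 (hmem𝒯.1 hT).1).2
  -- enumerations of the triangles
  have henum : ∀ T ∈ 𝒯, ∃ a b c' : X, a ≠ b ∧ a ≠ c' ∧ b ≠ c' ∧ T = {a, b, c'} := fun T hT =>
    Finset.card_eq_three.1 (hmem𝒯.1 hT).1.card_eq_three
  haveI : Nonempty X := ⟨x⟩
  choose! va vb vc hab hac hbc hTeq using henum
  have hva : ∀ T ∈ 𝒯, va T ∈ T := fun T hT => by
    have h : va T ∈ ({va T, vb T, vc T} : Finset X) := by simp
    rwa [← hTeq T hT] at h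
  have hvb : ∀ T ∈ 𝒯, vb T ∈ T := fun T hT => by
    have h : vb T ∈ ({va T, vb T, vc T} : Finset X) := by simp
    rwa [← hTeq T hT] at h
  have hvc : ∀ T ∈ 𝒯, vc T ∈ T := fun T hT => by
    have h : vc T ∈ ({va T, vb T, vc T} : Finset X) := by simp
    rwa [← hTeq T hT] at h
  have sab : ∀ T ∈ 𝒯, IsShortRange α y (va T) (vb T) := fun T hT =>
    hTsr T hT _ (hva T hT) _ (hvb T hT) (hab T hT)
  have sac : ∀ T ∈ 𝒯, IsShortRange α y (va T) (vc T) := fun T hT =>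
    hTsr T hT _ (hva T hT) _ (hvc T hT) (hac T hT)
  have sbc : ∀ T ∈ 𝒯, IsShortRange α y (vb T) (vc T) := fun T hT =>
    hTsr T hT _ (hvb T hT) _ (hvc T hT) (hbc T hT)
  -- the interpolations
  set uT : Finset X → Plane → Plane := fun T ξ =>
    interp (yTri y (va T) (vb T) (vc T)) (ηTri Φ (va T) (vb T) (vc T)) ξ with huT
  have hDy : ∀ T ∈ 𝒯, det₂ (yTri y (va T) (vb T) (vc T) 1 - yTri y (va T) (vb T) (vc T) 0)
      (yTri y (va T) (vb T) (vc T) 2 - yTri y (va T) (vb T) (vc T) 0) ≠ 0 := fun T hT =>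
    det₂_yTri_ne_zero hα hα' (sab T hT) (sac T hT) (sbc T hT)
  have hvert : ∀ T ∈ 𝒯, ∀ v ∈ T, uT T (y v) = triPoint (Φ v) := by
    intro T hT v hv
    rw [hTeq T hT] at hv
    obtain ⟨i, hyi, hηi⟩ := exists_index_of_mem (y := y) (Φ := Φ) hv
    simp only [huT]
    rw [hyi, interp_vertex _ _ (hDy T hT), hηi]
  have hedge : ∀ T ∈ 𝒯, ∀ p ∈ T, ∀ q ∈ T, ∀ s : ℝ,
      uT T (y p + s • (y q - y p)) = triPoint (Φ p) + s • (triPoint (Φ q) - triPoint (Φ p)) := by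
    intro T hT p hp q hq s
    rw [hTeq T hT] at hp hq
    obtain ⟨i, hyi, hηi⟩ := exists_index_of_mem (y := y) (Φ := Φ) hp
    obtain ⟨j, hyj, hηj⟩ := exists_index_of_mem (y := y) (Φ := Φ) hq
    simp only [huT]
    rw [hyi, hyj, interp_edge _ _ (hDy T hT), hηi, hηj]
  -- the interpolations agree on overlaps
  have huu : ∀ T ∈ 𝒯, ∀ T' ∈ 𝒯, ∀ ξ : Plane, ξ ∈ convexHull ℝ (y '' ↑T) →
      ξ ∈ convexHull ℝ (y '' ↑T') → uT T ξ = uT T' ξ := by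
    intro T hT T' hT' ξ hξ hξ'
    by_cases hTT' : T = T'
    · rw [hTT']
    have hface := convexHull_inter_convexHull_subset_face hα hα' hsep (hmem𝒯.1 hT).1
      (hmem𝒯.1 hT').1 hTT' (hTgood T hT) (hTgood T' hT') ⟨hξ, hξ'⟩
    have hlt : (T ∩ T').card < 3 := by
      rw [← (hmem𝒯.1 hT).1.card_eq_three]
      refine Finset.card_lt_card (Finset.ssubset_iff_subset_ne.2 ⟨Finset.inter_subset_left, ?_⟩)
      intro heq
      apply hTT'
      have hsub : T ⊆ T' := by rw [← heq]; exact Finset.inter_subset_right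
      exact Finset.eq_of_subset_of_card_le hsub
        (by rw [(hmem𝒯.1 hT).1.card_eq_three, (hmem𝒯.1 hT').1.card_eq_three])
    obtain h0 | h1 | h2 : (T ∩ T').card = 0 ∨ (T ∩ T').card = 1 ∨ (T ∩ T').card = 2 := by
      omega
    · rw [Finset.card_eq_zero] at h0
      rw [h0, Finset.coe_empty, image_empty, convexHull_empty] at hface
      exact absurd hface (notMem_empty _)
    · obtain ⟨v, hv⟩ := Finset.card_eq_one.1 h1
      have hvT : v ∈ T ∩ T' := by rw [hv]; exact Finset.mem_singleton_self v
      rw [hv, Finset.coe_singleton, image_singleton, convexHull_singleton, mem_singleton_iff]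
        at hface
      rw [hface, hvert T hT v (Finset.mem_inter.1 hvT).1, hvert T' hT' v (Finset.mem_inter.1 hvT).2]
    · obtain ⟨p, q, hpq, hpq'⟩ := Finset.card_eq_two.1 h2
      have hpT : p ∈ T ∩ T' := by rw [hpq']; simp
      have hqT : q ∈ T ∩ T' := by rw [hpq']; simp
      rw [hpq', Finset.coe_insert, Finset.coe_singleton, image_insert_eq, image_singleton,
        convexHull_pair, segment_eq_image'] at hface
      obtain ⟨s, -, rfl⟩ := hface
      rw [hedge T hT p (Finset.mem_inter.1 hpT).1 q (Finset.mem_inter.1 hqT).1,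
        hedge T' hT' p (Finset.mem_inter.1 hpT).2 q (Finset.mem_inter.1 hqT).2]
  -- the global interpolation
  set ℓ : Plane → Plane := fun ξ =>
    if h : ∃ T ∈ 𝒯, ξ ∈ convexHull ℝ (y '' ↑T) then uT h.choose ξ else 0 with hℓ
  have hℓT : ∀ T ∈ 𝒯, ∀ ξ ∈ convexHull ℝ (y '' ↑T), ℓ ξ = uT T ξ := by
    intro T hT ξ hξ
    have h : ∃ T ∈ 𝒯, ξ ∈ convexHull ℝ (y '' ↑T) := ⟨T, hT, hξ⟩
    simp only [hℓ, dif_pos h]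
    exact huu _ h.choose_spec.1 T hT ξ h.choose_spec.2 hξ
  -- the segment and the cover pulled back to `[0, 1]`
  set d : Plane := y x' - y x with hd
  set γ : ℝ → Plane := fun u => y x + u • d with hγ
  have hγc : Continuous γ := continuous_const.add (continuous_id.smul continuous_const)
  have hγseg : ∀ u ∈ Icc (0 : ℝ) 1, γ u ∈ ball c r := fun u hu => by
    have : γ u ∈ segment ℝ (y x) (y x') := by
      rw [segment_eq_image']
      exact mem_image_of_mem _ hu
    exact (convex_ball c r).segment_subset hx hx' this
  have hcovI : Icc (0 : ℝ) 1 ⊆ ⋃ T ∈ 𝒯, γ ⁻¹' convexHull ℝ (y '' ↑T) := fun u hu => by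
    obtain ⟨T, hT, huT⟩ := hcov (γ u) (hγseg u hu)
    exact mem_iUnion₂.2 ⟨T, hT, huT⟩
  have hclosed : ∀ T ∈ 𝒯, IsClosed (γ ⁻¹' convexHull ℝ (y '' ↑T)) := fun T _ =>
    ((T.finite_toSet.image y).isCompact_convexHull ℝ).isClosed.preimage hγc
  -- Lipschitz bound on each piece
  set L : ℝ := (1 - K * α)⁻¹ * dist (y x) (y x') with hL
  have hlip : ∀ T ∈ 𝒯, ∀ u ∈ γ ⁻¹' convexHull ℝ (y '' ↑T), ∀ v ∈ γ ⁻¹' convexHull ℝ (y '' ↑T),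
      ‖ℓ (γ v) - ℓ (γ u)‖ ≤ L * |v - u| := by
    intro T hT u hu v hv
    rw [hℓT T hT _ hu, hℓT T hT _ hv]
    simp only [huT]
    rw [interp_sub]
    have hγvu : γ v - γ u = (v - u) • d := by
      simp only [hγ]
      rw [add_sub_add_left_eq_sub, sub_smul]
    rw [hγvu, map_smul, norm_smul, Real.norm_eq_abs]
    obtain ⟨ω', hΦ', haω, hbω, hcω⟩ := hloc (hTball T hT _ (hva T hT)) (hTball T hT _ (hvb T hT))
      (hTball T hT _ (hvc T hT)) (sab T hT) (sac T hT) (sbc T hT)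
    have hG := triangle_inv_lipschitz hBL hΦ' hα hα' hαα₀ haω hbω hcω (sab T hT) (sac T hT)
      (sbc T hT) d
    have hG' : ‖interpLin (yTri y (va T) (vb T) (vc T)) (ηTri Φ (va T) (vb T) (vc T)) d‖ ≤
        (1 - K * α)⁻¹ * ‖d‖ := by
      rw [← div_eq_inv_mul, le_div_iff₀' h1K]
      exact hG
    have hdn : ‖d‖ = dist (y x) (y x') := by rw [hd, ← dist_eq_norm, dist_comm]
    rw [hdn] at hG'
    calc |v - u| * ‖interpLin (yTri y (va T) (vb T) (vc T)) (ηTri Φ (va T) (vb T) (vc T)) d‖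
        ≤ |v - u| * L := mul_le_mul_of_nonneg_left hG' (abs_nonneg _)
      _ = L * |v - u| := mul_comm _ _
  -- telescoping
  have hchain := norm_sub_le_of_cover_Icc (fun T : Finset X => γ ⁻¹' convexHull ℝ (y '' ↑T))
    (fun u => ℓ (γ u)) L 𝒯 0 1 zero_le_one hclosed hlip hcovI
  -- the endpoints
  have hγ0 : γ 0 = y x := by simp [hγ]
  have hγ1 : γ 1 = y x' := by simp [hγ, hd]
  have hend : ∀ z : X, y z ∈ ball c r → ℓ (y z) = triPoint (Φ z) := by
    intro z hz
    obtain ⟨T, hT, hzT⟩ := hcov (y z) hz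
    rw [hℓT T hT _ hzT]
    have hzT' : y z ∈ convexHull ℝ {y (va T), y (vb T), y (vc T)} := by
      rw [hTeq T hT, image_coe_triple] at hzT
      exact hzT
    have hmem := mem_of_mem_convexHull_triple hα hα' hsep (sab T hT) (sac T hT) (sbc T hT)
      (hTgood T hT _ (hva T hT)) hzT'
    have hz' : z ∈ T := by
      rw [hTeq T hT]
      rcases hmem with h | h | h <;> simp [h]
    exact hvert T hT z hz'
  rw [hγ0, hγ1, hend x hx, hend x' hx', sub_zero, mul_one] at hchain
  rwa [dist_comm, dist_eq_norm]

end Upper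

/-! ### The perfect lattice as a configuration: unit triangles of `A₂` -/

section Lattice

variable {α : ℝ}

/-- `α ≤ 1/200 < √3 − 1`. [folklore] -/
private theorem lt_sqrt_three_sub_one (hα' : α ≤ 1 / 200) : α < √3 - 1 := by
  have h : (3 : ℝ) / 2 < √3 := by
    rw [show (3 : ℝ) / 2 = √(9 / 4) by
      rw [show (9 : ℝ) / 4 = (3 / 2) ^ 2 by norm_num, Real.sqrt_sq (by norm_num)]]
    exact Real.sqrt_lt_sqrt (by norm_num) (by norm_num)
  linarith

/-- The perfect lattice satisfies (13): distinct lattice points are `≥ 1 > 1 − α` apart.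
[cite: Theil2006, §2.3 Remark 2.5 (preprint p. 7)] -/
private theorem sep_triPoint (hα : 0 < α) :
    ∀ k k' : ℤ × ℤ, k ≠ k' → 1 - α < dist (triPoint k) (triPoint k') := by
  intro k k' hkk'
  rw [dist_triPoint]
  have h1 := one_le_norm_triPoint (sub_ne_zero.2 hkk')
  linarith

/-- Lattice points in a disc form a finite set. [folklore] -/
private theorem finite_lattice_dist_le (P : Plane) (M : ℝ) :
    {η : ℤ × ℤ | dist (triPoint η) P ≤ M}.Finite := by
  have h := (tendsto_norm_triPoint_cofinite.eventually_gt_atTop (M + ‖P‖))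
  simp only [Filter.eventually_cofinite, not_lt] at h
  refine h.subset fun η hη => ?_
  rw [mem_setOf_eq] at hη ⊢
  have := norm_le_norm_add_norm_sub' (triPoint η) P
  rw [← dist_eq_norm] at this
  linarith

/-- A point of the hull of a set all of whose points are within `m` of `P` is within `m` of `P`.
[folklore] -/
private theorem dist_le_of_mem_convexHull {s : Set Plane} {P f : Plane} {m : ℝ}
    (hs : ∀ Q ∈ s, dist Q P ≤ m) (hf : f ∈ convexHull ℝ s) : dist f P ≤ m := by
  have h : convexHull ℝ s ⊆ closedBall P m :=
    convexHull_min (fun Q hQ => mem_closedBall.2 (hs Q hQ)) (convex_closedBall P m)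
  exact mem_closedBall.1 (h hf)

/-- An explicit convex combination of three points lies in their convex hull. [folklore] -/
private theorem mem_convexHull_triple_of_eq {P Q R f : Plane} {a b c : ℝ} (ha : 0 ≤ a)
    (hb : 0 ≤ b) (hc : 0 ≤ c) (habc : a + b + c = 1) (hf : f = a • P + b • Q + c • R) :
    f ∈ convexHull ℝ ({P, Q, R} : Set Plane) := by
  have hconv : Convex ℝ (convexHull ℝ ({P, Q, R} : Set Plane)) := convex_convexHull ℝ _
  have hP : P ∈ convexHull ℝ ({P, Q, R} : Set Plane) := subset_convexHull ℝ _ (by simp)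
  have hQ : Q ∈ convexHull ℝ ({P, Q, R} : Set Plane) := subset_convexHull ℝ _ (by simp)
  have hR : R ∈ convexHull ℝ ({P, Q, R} : Set Plane) := subset_convexHull ℝ _ (by simp)
  have h := hconv.sum_mem (t := Finset.univ) (w := ![a, b, c]) (z := ![P, Q, R])
    (fun i _ => by fin_cases i <;> assumption) (by simp [Fin.sum_univ_three, habc])
    (fun i _ => by fin_cases i <;> assumption)
  rw [hf]
  simpa [Fin.sum_univ_three] using h

/-- `triPoint` on a three-element finset of labels. [folklore] -/
private theorem image_triPoint_triple (p q r : ℤ × ℤ) :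
    triPoint '' ↑({p, q, r} : Finset (ℤ × ℤ)) = {triPoint p, triPoint q, triPoint r} := by
  rw [Finset.coe_insert, Finset.coe_insert, Finset.coe_singleton, image_insert_eq,
    image_insert_eq, image_singleton]

/-- **The closed unit triangles of `A₂` cover the plane**: every point of `ℝ²` lies in
`conv(triPoint(T))` for a unit lattice triangle `T` (a short-range simplex of the perfect
lattice, `0 ≤ α < √3 − 1`): in lattice coordinates `(s, t)` with integer parts `(i, j)` and
fractional parts `(a, b)`, the triangle `{(i,j), (i+1,j), (i,j+1)}` if `a + b ≤ 1` and
`{(i+1,j+1), (i,j+1), (i+1,j)}` otherwise. [cite: Theil2006, §4.2 Lemma 4.6 («closed lattice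
triangles», preprint p. 19); our lemma] -/
private theorem exists_latticeTriangle (hα0 : 0 ≤ α) (hα3 : α < √3 - 1) (f : Plane) :
    ∃ T : Finset (ℤ × ℤ), IsEquilateralSimplex α triPoint 1 T ∧
      f ∈ convexHull ℝ (triPoint '' ↑T) := by
  classical
  have h3 : 0 < √3 := Real.sqrt_pos.2 (by norm_num)
  set t : ℝ := 2 / √3 * f 1 with ht
  set s : ℝ := f 0 - t / 2 with hs
  set i : ℤ := ⌊s⌋ with hi
  set j : ℤ := ⌊t⌋ with hj
  have ha0 : 0 ≤ s - i := sub_nonneg.2 (Int.floor_le s)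
  have ha1 : s - i < 1 := by have := Int.lt_floor_add_one s; linarith
  have hb0 : 0 ≤ t - j := sub_nonneg.2 (Int.floor_le t)
  have hb1 : t - j < 1 := by have := Int.lt_floor_add_one t; linarith
  have hf0 : f 0 = s + t / 2 := by rw [hs]; ring
  have hf1 : f 1 = √3 / 2 * t := by
    rw [ht]; field_simp
  -- short-range pairs of the lattice are the unit steps
  have hsr : ∀ p q : ℤ × ℤ, q - p ∈ unitShell → IsShortRange α triPoint p q := fun p q h =>
    (isShortRange_triPoint_iff hα0 hα3).2 h
  by_cases hab : s - i + (t - j) ≤ 1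
  · refine ⟨{(i, j), (i + 1, j), (i, j + 1)}, ?_, ?_⟩
    · rw [isEquilateralSimplex_one_iff]
      refine ⟨Finset.card_eq_three.2 ⟨(i, j), (i + 1, j), (i, j + 1), by simp, by simp,
        by simp [Prod.ext_iff], rfl⟩, ?_⟩
      intro p hp q hq hpq
      simp only [Finset.mem_insert, Finset.mem_singleton] at hp hq
      rcases hp with rfl | rfl | rfl <;> rcases hq with rfl | rfl | rfl <;>
        first
        | exact absurd rfl hpq
        | (apply hsr; simp [unitShell])
    · rw [image_triPoint_triple]
      refine mem_convexHull_triple_of_eq (a := 1 - (s - i) - (t - j)) (b := s - i) (c := t - j)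
        (by linarith) ha0 hb0 (by ring) ?_
      ext k
      fin_cases k
      · simp only [Fin.zero_eta, Fin.isValue, PiLp.add_apply, PiLp.smul_apply, smul_eq_mul,
          triPoint_apply_zero]
        push_cast
        rw [hf0]; ring
      · simp only [Fin.mk_one, Fin.isValue, PiLp.add_apply, PiLp.smul_apply, smul_eq_mul,
          triPoint_apply_one]
        push_cast
        rw [hf1]; ring
  · push Not at hab
    refine ⟨{(i + 1, j + 1), (i, j + 1), (i + 1, j)}, ?_, ?_⟩
    · rw [isEquilateralSimplex_one_iff]
      refine ⟨Finset.card_eq_three.2 ⟨(i + 1, j + 1), (i, j + 1), (i + 1, j), by simp,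
        by simp, by simp [Prod.ext_iff], rfl⟩, ?_⟩
      intro p hp q hq hpq
      simp only [Finset.mem_insert, Finset.mem_singleton] at hp hq
      rcases hp with rfl | rfl | rfl <;> rcases hq with rfl | rfl | rfl <;>
        first
        | exact absurd rfl hpq
        | (apply hsr; simp [unitShell])
    · rw [image_triPoint_triple]
      refine mem_convexHull_triple_of_eq (a := s - i + (t - j) - 1) (b := 1 - (s - i))
        (c := 1 - (t - j)) (by linarith) (by linarith) (by linarith) (by ring) ?_
      ext k
      fin_cases k
      · simp only [Fin.zero_eta, Fin.isValue, PiLp.add_apply, PiLp.smul_apply, smul_eq_mul,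
          triPoint_apply_zero]
        push_cast
        rw [hf0]; ring
      · simp only [Fin.mk_one, Fin.isValue, PiLp.add_apply, PiLp.smul_apply, smul_eq_mul,
          triPoint_apply_one]
        push_cast
        rw [hf1]; ring

/-- Short-range pairs of the perfect lattice are at distance exactly `1`.
[cite: Theil2006, §2.3 Remark 2.5 (preprint p. 7)] -/
private theorem dist_triPoint_eq_one_of_isShortRange (hα0 : 0 ≤ α) (hα3 : α < √3 - 1)
    {p q : ℤ × ℤ} (h : IsShortRange α triPoint p q) : dist (triPoint p) (triPoint q) = 1 := by
  rw [dist_comm, dist_triPoint]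
  exact norm_triPoint_of_mem_unitShell ((isShortRange_triPoint_iff hα0 hα3).1 h)

end Lattice

/-! ### The lower bound: telescoping along the label segment through realized unit triangles -/

section Lower

variable {X : Type*} {α : ℝ} {y : X → Plane} {ω : Set X} {Φ : X → ℤ × ℤ}

/-- A lattice triangle is *realized* by the imbedding `Φ` of the patch `ω` if each of its
vertices is the label of a non-defective particle of `ω` whose whole neighbourhood lies in `ω`
(so that Remark 2.5 applies at it). [cite: Theil2006, §2.3 Remark 2.5 (preprint p. 7); our
bookkeeping] -/
private def Realized (α : ℝ) (y : X → Plane) (ω : Set X) (Φ : X → ℤ × ℤ) (T : Finset (ℤ × ℤ)) :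
    Prop :=
  ∀ η ∈ T, ∃ p ∈ ω, Φ p = η ∧ p ∉ defectSet α y ∧ nbhdSet α y p ⊆ ω

/-- **(61), lower half, for every discrete imbedding** (explicit constants; realizability as a
hypothesis): if every unit lattice triangle meeting the label segment `[Φ(x), Φ(x′)]` is
realized by particles of `ω`, then `|y(x) − y(x′)| ≤ (1 + Kα)|Φ(x) − Φ(x′)|`. Proof:
telescoping of the affine interpolations `Φ(v) ↦ y(v)` along the label segment through the
closed unit triangles of `A₂`, which form an embedded complex and on which the gradients are
`≤ 1 + Kα` by Lemma 4.2. [cite: Theil2006, §4.2 Proposition 4.8 (2) (61) (preprint pp. 21, 23);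
our proof, without Proposition 4.1] -/
private theorem dist_le_aux {K α₀ : ℝ} (hBL : SimplexBiLipschitz K α₀)
    (hΦ : IsDiscreteImbeddingOn α y ω Φ) (hα : 0 < α) (hα' : α ≤ 1 / 200) (hαα₀ : α ≤ α₀)
    {x x' : X} (hx : x ∈ ω) (hx' : x' ∈ ω)
    (hreal : ∀ T : Finset (ℤ × ℤ), IsEquilateralSimplex α triPoint 1 T →
      (∃ f ∈ convexHull ℝ (triPoint '' ↑T), f ∈ segment ℝ (triPoint (Φ x)) (triPoint (Φ x'))) →
      Realized α y ω Φ T) :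
    dist (y x) (y x') ≤ (1 + K * α) * dist (triPoint (Φ x)) (triPoint (Φ x')) := by
  classical
  have hα1 : α < 1 := by linarith
  have hα3 : α < √3 - 1 := lt_sqrt_three_sub_one hα'
  have hsepΛ := sep_triPoint hα
  have hgoodΛ : ∀ v : ℤ × ℤ, v ∉ defectSet α (triPoint : ℤ × ℤ → Plane) := fun v hv => by
    rw [defectSet_triPoint_eq_empty hα.le hα3] at hv
    exact hv
  set G₀ : Plane := triPoint (Φ x) with hG₀
  set G₁ : Plane := triPoint (Φ x') with hG₁
  set D : ℝ := dist G₀ G₁ with hD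
  -- a right inverse of the labelling on `ω`
  haveI : Nonempty X := ⟨x⟩
  set Ψ : ℤ × ℤ → X := fun g => if h : ∃ p ∈ ω, Φ p = g then h.choose else x with hΨ
  have hΨspec : ∀ g : ℤ × ℤ, (∃ p ∈ ω, Φ p = g) → Ψ g ∈ ω ∧ Φ (Ψ g) = g := by
    intro g h
    simp only [hΨ, dif_pos h]
    exact h.choose_spec
  have hΨΦ : ∀ p ∈ ω, Ψ (Φ p) = p := by
    intro p hp
    have h : ∃ p' ∈ ω, Φ p' = Φ p := ⟨p, hp, rfl⟩
    exact hΦ.injOn (hΨspec _ h).1 hp (hΨspec _ h).2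
  -- the finite family of realized unit triangles near the segment
  obtain ⟨Λ₀, hΛ₀⟩ := (finite_lattice_dist_le G₀ (D + 1)).exists_finset_coe
  set 𝒞 : Finset (Finset (ℤ × ℤ)) :=
    Λ₀.powerset.filter (fun T => IsEquilateralSimplex α triPoint 1 T ∧ Realized α y ω Φ T)
    with h𝒞
  have hmem𝒞 : ∀ {T : Finset (ℤ × ℤ)}, T ∈ 𝒞 ↔ (∀ η ∈ T, dist (triPoint η) G₀ ≤ D + 1) ∧
      IsEquilateralSimplex α triPoint 1 T ∧ Realized α y ω Φ T := by
    intro T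
    simp only [h𝒞, Finset.mem_filter, Finset.mem_powerset]
    constructor
    · rintro ⟨hsub, h1, h2⟩
      refine ⟨fun η hη => ?_, h1, h2⟩
      have := hsub hη
      rw [← Finset.mem_coe, hΛ₀] at this
      exact this
    · rintro ⟨hsub, h1, h2⟩
      refine ⟨fun η hη => ?_, h1, h2⟩
      rw [← Finset.mem_coe, hΛ₀]
      exact hsub η hη
  have h𝒞sr : ∀ T ∈ 𝒞, ∀ p ∈ T, ∀ q ∈ T, p ≠ q → IsShortRange α triPoint p q := fun T hT =>
    (isEquilateralSimplex_one_iff.1 (hmem𝒞.1 hT).2.1).2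
  -- particles realizing the vertices
  have hP : ∀ T ∈ 𝒞, ∀ η ∈ T,
      Ψ η ∈ ω ∧ Φ (Ψ η) = η ∧ Ψ η ∉ defectSet α y ∧ nbhdSet α y (Ψ η) ⊆ ω := by
    intro T hT η hη
    obtain ⟨p, hp, hpη, hpd, hpN⟩ := (hmem𝒞.1 hT).2.2 η hη
    have h : ∃ p ∈ ω, Φ p = η := ⟨p, hp, hpη⟩
    have hΨη : Ψ η = p := by rw [← hpη, hΨΦ p hp]
    rw [hΨη]
    exact ⟨hp, hpη, hpd, hpN⟩
  have hPsr : ∀ T ∈ 𝒞, ∀ p ∈ T, ∀ q ∈ T, p ≠ q → IsShortRange α y (Ψ p) (Ψ q) := by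
    intro T hT p hp q hq hpq
    have h1 : dist (triPoint (Φ (Ψ p))) (triPoint (Φ (Ψ q))) = 1 := by
      rw [(hP T hT p hp).2.1, (hP T hT q hq).2.1]
      exact dist_triPoint_eq_one_of_isShortRange hα.le hα3 (h𝒞sr T hT p hp q hq hpq)
    exact hΦ.isShortRange_of_dist_eq_one hα1 (hP T hT p hp).2.2.1 (hP T hT p hp).2.2.2
      (hP T hT q hq).1 h1
  -- enumerations of the triangles
  have henum : ∀ T ∈ 𝒞, ∃ a b c' : ℤ × ℤ, a ≠ b ∧ a ≠ c' ∧ b ≠ c' ∧ T = {a, b, c'} := fun T hT =>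
    Finset.card_eq_three.1 (hmem𝒞.1 hT).2.1.card_eq_three
  choose! ea eb ec heab heac hebc hTeq using henum
  have hea : ∀ T ∈ 𝒞, ea T ∈ T := fun T hT => by
    have h : ea T ∈ ({ea T, eb T, ec T} : Finset (ℤ × ℤ)) := by simp
    rwa [← hTeq T hT] at h
  have heb : ∀ T ∈ 𝒞, eb T ∈ T := fun T hT => by
    have h : eb T ∈ ({ea T, eb T, ec T} : Finset (ℤ × ℤ)) := by simp
    rwa [← hTeq T hT] at h
  have hec : ∀ T ∈ 𝒞, ec T ∈ T := fun T hT => by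
    have h : ec T ∈ ({ea T, eb T, ec T} : Finset (ℤ × ℤ)) := by simp
    rwa [← hTeq T hT] at h
  -- the particles of a triangle and their short-range bonds
  have sab : ∀ T ∈ 𝒞, IsShortRange α y (Ψ (ea T)) (Ψ (eb T)) := fun T hT =>
    hPsr T hT _ (hea T hT) _ (heb T hT) (heab T hT)
  have sac : ∀ T ∈ 𝒞, IsShortRange α y (Ψ (ea T)) (Ψ (ec T)) := fun T hT =>
    hPsr T hT _ (hea T hT) _ (hec T hT) (heac T hT)
  have sbc : ∀ T ∈ 𝒞, IsShortRange α y (Ψ (eb T)) (Ψ (ec T)) := fun T hT =>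
    hPsr T hT _ (heb T hT) _ (hec T hT) (hebc T hT)
  -- the interpolations `Φ(v) ↦ y(v)`
  set vT : Finset (ℤ × ℤ) → Plane → Plane := fun T f =>
    interp (ηTri Φ (Ψ (ea T)) (Ψ (eb T)) (Ψ (ec T))) (yTri y (Ψ (ea T)) (Ψ (eb T)) (Ψ (ec T))) f
    with hvT
  have hDη : ∀ T ∈ 𝒞, det₂ (ηTri Φ (Ψ (ea T)) (Ψ (eb T)) (Ψ (ec T)) 1 -
      ηTri Φ (Ψ (ea T)) (Ψ (eb T)) (Ψ (ec T)) 0) (ηTri Φ (Ψ (ea T)) (Ψ (eb T)) (Ψ (ec T)) 2 -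
      ηTri Φ (Ψ (ea T)) (Ψ (eb T)) (Ψ (ec T)) 0) ≠ 0 := fun T hT =>
    det₂_ηTri_ne_zero hΦ hα1 (hP T hT _ (hea T hT)).1 (hP T hT _ (heb T hT)).1
      (hP T hT _ (hec T hT)).1 (sab T hT) (sac T hT) (sbc T hT)
  have hindex : ∀ T ∈ 𝒞, ∀ η ∈ T, ∃ i : Fin 3,
      triPoint η = ηTri Φ (Ψ (ea T)) (Ψ (eb T)) (Ψ (ec T)) i ∧
        y (Ψ η) = yTri y (Ψ (ea T)) (Ψ (eb T)) (Ψ (ec T)) i := by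
    intro T hT η hη
    have hη' := hη
    rw [hTeq T hT] at hη'
    simp only [Finset.mem_insert, Finset.mem_singleton] at hη'
    rcases hη' with rfl | rfl | rfl
    · exact ⟨0, by rw [ηTri_zero, (hP T hT _ hη).2.1], rfl⟩
    · exact ⟨1, by rw [ηTri_one, (hP T hT _ hη).2.1], rfl⟩
    · exact ⟨2, by rw [ηTri_two, (hP T hT _ hη).2.1], rfl⟩
  have hvert : ∀ T ∈ 𝒞, ∀ η ∈ T, vT T (triPoint η) = y (Ψ η) := by
    intro T hT η hη
    obtain ⟨i, hηi, hyi⟩ := hindex T hT η hη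
    simp only [hvT]
    rw [hηi, interp_vertex _ _ (hDη T hT), hyi]
  have hedge : ∀ T ∈ 𝒞, ∀ p ∈ T, ∀ q ∈ T, ∀ s : ℝ,
      vT T (triPoint p + s • (triPoint q - triPoint p)) = y (Ψ p) + s • (y (Ψ q) - y (Ψ p)) := by
    intro T hT p hp q hq s
    obtain ⟨i, hηi, hyi⟩ := hindex T hT p hp
    obtain ⟨j, hηj, hyj⟩ := hindex T hT q hq
    simp only [hvT]
    rw [hηi, hηj, interp_edge _ _ (hDη T hT), hyi, hyj]
  -- the interpolations agree on overlaps (the unit triangles of `A₂` form an embedded complex)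
  have hvv : ∀ T ∈ 𝒞, ∀ T' ∈ 𝒞, ∀ f : Plane, f ∈ convexHull ℝ (triPoint '' ↑T) →
      f ∈ convexHull ℝ (triPoint '' ↑T') → vT T f = vT T' f := by
    intro T hT T' hT' f hf hf'
    by_cases hTT' : T = T'
    · rw [hTT']
    have hface := convexHull_inter_convexHull_subset_face hα hα' hsepΛ (hmem𝒞.1 hT).2.1
      (hmem𝒞.1 hT').2.1 hTT' (fun v _ => hgoodΛ v) (fun v _ => hgoodΛ v) ⟨hf, hf'⟩
    have hlt : (T ∩ T').card < 3 := by
      rw [← (hmem𝒞.1 hT).2.1.card_eq_three]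
      refine Finset.card_lt_card (Finset.ssubset_iff_subset_ne.2 ⟨Finset.inter_subset_left, ?_⟩)
      intro heq
      apply hTT'
      have hsub : T ⊆ T' := by rw [← heq]; exact Finset.inter_subset_right
      exact Finset.eq_of_subset_of_card_le hsub
        (by rw [(hmem𝒞.1 hT).2.1.card_eq_three, (hmem𝒞.1 hT').2.1.card_eq_three])
    obtain h0 | h1 | h2 : (T ∩ T').card = 0 ∨ (T ∩ T').card = 1 ∨ (T ∩ T').card = 2 := by
      omega
    · rw [Finset.card_eq_zero] at h0
      rw [h0, Finset.coe_empty, image_empty, convexHull_empty] at hface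
      exact absurd hface (notMem_empty _)
    · obtain ⟨v, hv⟩ := Finset.card_eq_one.1 h1
      have hvT : v ∈ T ∩ T' := by rw [hv]; exact Finset.mem_singleton_self v
      rw [hv, Finset.coe_singleton, image_singleton, convexHull_singleton, mem_singleton_iff]
        at hface
      rw [hface, hvert T hT v (Finset.mem_inter.1 hvT).1,
        hvert T' hT' v (Finset.mem_inter.1 hvT).2]
    · obtain ⟨p, q, hpq, hpq'⟩ := Finset.card_eq_two.1 h2
      have hpT : p ∈ T ∩ T' := by rw [hpq']; simp
      have hqT : q ∈ T ∩ T' := by rw [hpq']; simp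
      rw [hpq', Finset.coe_insert, Finset.coe_singleton, image_insert_eq, image_singleton,
        convexHull_pair, segment_eq_image'] at hface
      obtain ⟨s, -, rfl⟩ := hface
      rw [hedge T hT p (Finset.mem_inter.1 hpT).1 q (Finset.mem_inter.1 hqT).1,
        hedge T' hT' p (Finset.mem_inter.1 hpT).2 q (Finset.mem_inter.1 hqT).2]
  -- the global interpolation on the label side
  set ℓ : Plane → Plane := fun f =>
    if h : ∃ T ∈ 𝒞, f ∈ convexHull ℝ (triPoint '' ↑T) then vT h.choose f else 0 with hℓ
  have hℓT : ∀ T ∈ 𝒞, ∀ f ∈ convexHull ℝ (triPoint '' ↑T), ℓ f = vT T f := by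
    intro T hT f hf
    have h : ∃ T ∈ 𝒞, f ∈ convexHull ℝ (triPoint '' ↑T) := ⟨T, hT, hf⟩
    simp only [hℓ, dif_pos h]
    exact hvv _ h.choose_spec.1 T hT f h.choose_spec.2 hf
  -- the label segment and the cover pulled back to `[0, 1]`
  set d : Plane := G₁ - G₀ with hd
  set γ : ℝ → Plane := fun u => G₀ + u • d with hγ
  have hγc : Continuous γ := continuous_const.add (continuous_id.smul continuous_const)
  have hdn : ‖d‖ = D := by rw [hd, hD, ← dist_eq_norm, dist_comm]
  have hγseg : ∀ u ∈ Icc (0 : ℝ) 1, γ u ∈ segment ℝ G₀ G₁ := fun u hu => by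
    rw [segment_eq_image']
    exact mem_image_of_mem _ hu
  have hγdist : ∀ u ∈ Icc (0 : ℝ) 1, dist (γ u) G₀ ≤ D := fun u hu => by
    simp only [hγ]
    rw [dist_eq_norm, add_sub_cancel_left, norm_smul, Real.norm_eq_abs, abs_of_nonneg hu.1, hdn]
    have hD0 : 0 ≤ D := dist_nonneg
    nlinarith [hu.2]
  have hcovI : Icc (0 : ℝ) 1 ⊆ ⋃ T ∈ 𝒞, γ ⁻¹' convexHull ℝ (triPoint '' ↑T) := fun u hu => by
    obtain ⟨T, hT1, huT⟩ := exists_latticeTriangle hα.le hα3 (γ u)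
    have hTr : Realized α y ω Φ T := hreal T hT1 ⟨γ u, huT, hγseg u hu⟩
    have hTsr := (isEquilateralSimplex_one_iff.1 hT1).2
    have hnear : ∀ η ∈ T, dist (triPoint η) G₀ ≤ D + 1 := by
      intro η hη
      have h1 : dist (γ u) (triPoint η) ≤ 1 := by
        refine dist_le_of_mem_convexHull (fun Q hQ => ?_) huT
        obtain ⟨η', hη', rfl⟩ := hQ
        by_cases hηη' : η' = η
        · rw [hηη', dist_self]; exact zero_le_one
        · exact (dist_triPoint_eq_one_of_isShortRange hα.le hα3 (hTsr η' hη' η hη hηη')).le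
      calc dist (triPoint η) G₀ ≤ dist (triPoint η) (γ u) + dist (γ u) G₀ := dist_triangle _ _ _
        _ ≤ 1 + D := by rw [dist_comm]; exact add_le_add h1 (hγdist u hu)
        _ = D + 1 := add_comm _ _
    exact mem_iUnion₂.2 ⟨T, hmem𝒞.2 ⟨hnear, hT1, hTr⟩, huT⟩
  have hclosed : ∀ T ∈ 𝒞, IsClosed (γ ⁻¹' convexHull ℝ (triPoint '' ↑T)) := fun T _ =>
    ((T.finite_toSet.image triPoint).isCompact_convexHull ℝ).isClosed.preimage hγc
  -- Lipschitz bound on each piece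
  set L : ℝ := (1 + K * α) * D with hL
  have hlip : ∀ T ∈ 𝒞, ∀ u ∈ γ ⁻¹' convexHull ℝ (triPoint '' ↑T),
      ∀ v ∈ γ ⁻¹' convexHull ℝ (triPoint '' ↑T), ‖ℓ (γ v) - ℓ (γ u)‖ ≤ L * |v - u| := by
    intro T hT u hu v hv
    rw [hℓT T hT _ hu, hℓT T hT _ hv]
    simp only [hvT]
    rw [interp_sub]
    have hγvu : γ v - γ u = (v - u) • d := by
      simp only [hγ]
      rw [add_sub_add_left_eq_sub, sub_smul]
    rw [hγvu, map_smul, norm_smul, Real.norm_eq_abs]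
    have hF := (triangle_bilipschitz hBL hΦ hα1 hαα₀ (hP T hT _ (hea T hT)).1
      (hP T hT _ (heb T hT)).1 (hP T hT _ (hec T hT)).1 (sab T hT) (sac T hT) (sbc T hT) d).2
    rw [hdn] at hF
    calc |v - u| * ‖interpLin (ηTri Φ (Ψ (ea T)) (Ψ (eb T)) (Ψ (ec T)))
          (yTri y (Ψ (ea T)) (Ψ (eb T)) (Ψ (ec T))) d‖
        ≤ |v - u| * L := mul_le_mul_of_nonneg_left hF (abs_nonneg _)
      _ = L * |v - u| := mul_comm _ _
  -- telescoping
  have hchain := norm_sub_le_of_cover_Icc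
    (fun T : Finset (ℤ × ℤ) => γ ⁻¹' convexHull ℝ (triPoint '' ↑T)) (fun u => ℓ (γ u)) L 𝒞 0 1
    zero_le_one hclosed hlip hcovI
  -- the endpoints are labels, hence vertices of the triangles containing them
  have hγ0 : γ 0 = G₀ := by simp [hγ]
  have hγ1 : γ 1 = G₁ := by simp [hγ, hd]
  have hend : ∀ z : X, z ∈ ω → (∃ T ∈ 𝒞, triPoint (Φ z) ∈ convexHull ℝ (triPoint '' ↑T)) →
      ℓ (triPoint (Φ z)) = y z := by
    rintro z hz ⟨T, hT, hzT⟩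
    rw [hℓT T hT _ hzT]
    have hzT' : triPoint (Φ z) ∈ convexHull ℝ {triPoint (ea T), triPoint (eb T), triPoint (ec T)} := by
      rw [hTeq T hT, image_triPoint_triple] at hzT
      exact hzT
    have hsr := h𝒞sr T hT
    have hmem := mem_of_mem_convexHull_triple (y := (triPoint : ℤ × ℤ → Plane)) hα hα' hsepΛ
      (hsr _ (hea T hT) _ (heb T hT) (heab T hT)) (hsr _ (hea T hT) _ (hec T hT) (heac T hT))
      (hsr _ (heb T hT) _ (hec T hT) (hebc T hT)) (hgoodΛ _) hzT'
    have hz' : Φ z ∈ T := by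
      rw [hTeq T hT]
      rcases hmem with h | h | h <;> simp [h]
    rw [hvert T hT (Φ z) hz', hΨΦ z hz]
  have h0cov : ∃ T ∈ 𝒞, triPoint (Φ x) ∈ convexHull ℝ (triPoint '' ↑T) := by
    have := hcovI (left_mem_Icc.2 zero_le_one)
    rw [mem_iUnion₂] at this
    obtain ⟨T, hT, h⟩ := this
    exact ⟨T, hT, by rwa [mem_preimage, hγ0] at h⟩
  have h1cov : ∃ T ∈ 𝒞, triPoint (Φ x') ∈ convexHull ℝ (triPoint '' ↑T) := by
    have := hcovI (right_mem_Icc.2 zero_le_one)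
    rw [mem_iUnion₂] at this
    obtain ⟨T, hT, h⟩ := this
    exact ⟨T, hT, by rwa [mem_preimage, hγ1] at h⟩
  rw [hγ0, hγ1, hG₀, hG₁, hend x hx h0cov, hend x' hx' h1cov, sub_zero, mul_one] at hchain
  rwa [dist_comm, dist_eq_norm]

end Lower

/-! ### The hexagonal (graph) norm of `A₂` in labels -/

section HexNorm

/-- `hexLe v n`: the label `v = (a, b)` has graph distance `≤ n` from the origin in the
triangular lattice with unit steps `unitShell`, i.e. `max(|a|, |b|, |a + b|) ≤ n`. [folklore] -/
private def hexLe (v : ℤ × ℤ) (n : ℕ) : Prop :=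
  v.1 ≤ n ∧ -v.1 ≤ n ∧ v.2 ≤ n ∧ -v.2 ≤ n ∧ v.1 + v.2 ≤ n ∧ -(v.1 + v.2) ≤ n

/-- Graph distance `0` means the origin. [folklore] -/
private theorem eq_zero_of_hexLe_zero {v : ℤ × ℤ} (h : hexLe v 0) : v = 0 := by
  obtain ⟨h1, h2, h3, h4, -, -⟩ := h
  ext <;> simp <;> omega

/-- One unit step reduces the graph distance. [folklore] -/
private theorem hexLe_step {v : ℤ × ℤ} {n : ℕ} (h : hexLe v (n + 1)) :
    hexLe v n ∨ ∃ u ∈ unitShell, hexLe (v - u) n := by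
  obtain ⟨h1, h2, h3, h4, h5, h6⟩ := h
  by_cases hv : hexLe v n
  · exact Or.inl hv
  right
  simp only [hexLe, not_and_or, not_le] at hv
  push_cast at h1 h2 h3 h4 h5 h6 hv
  rcases le_or_gt 1 v.1 with ha | ha <;> rcases le_or_gt 1 v.2 with hb | hb
  · refine ⟨(1, 0), by simp [unitShell], ?_⟩
    simp only [hexLe, Prod.fst_sub, Prod.snd_sub, sub_zero]
    omega
  · rcases le_or_gt 0 v.2 with hb' | hb'
    · refine ⟨(1, 0), by simp [unitShell], ?_⟩
      simp only [hexLe, Prod.fst_sub, Prod.snd_sub, sub_zero]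
      omega
    · refine ⟨(1, -1), by simp [unitShell], ?_⟩
      simp only [hexLe, Prod.fst_sub, Prod.snd_sub, sub_neg_eq_add]
      omega
  · rcases le_or_gt 0 v.1 with ha' | ha'
    · refine ⟨(0, 1), by simp [unitShell], ?_⟩
      simp only [hexLe, Prod.fst_sub, Prod.snd_sub, sub_zero]
      omega
    · refine ⟨(-1, 1), by simp [unitShell], ?_⟩
      simp only [hexLe, Prod.fst_sub, Prod.snd_sub, sub_neg_eq_add]
      omega
  · -- `v.1 ≤ 0`, `v.2 ≤ 0`
    rcases le_or_gt v.1 (-1) with ha' | ha'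
    · refine ⟨(-1, 0), by simp [unitShell], ?_⟩
      simp only [hexLe, Prod.fst_sub, Prod.snd_sub, sub_zero, sub_neg_eq_add]
      omega
    · refine ⟨(0, -1), by simp [unitShell], ?_⟩
      simp only [hexLe, Prod.fst_sub, Prod.snd_sub, sub_zero, sub_neg_eq_add]
      omega

/-- The graph distance is at most `2/√3` times the Euclidean one:
`3 n² ≤ 4 (a² + ab + b²)` for `n = max(|a|, |b|, |a+b|)`. [folklore] -/
private theorem exists_hexLe_sq_le (v : ℤ × ℤ) :
    ∃ n : ℕ, hexLe v n ∧ 3 * (n : ℤ) ^ 2 ≤ 4 * (v.1 ^ 2 + v.1 * v.2 + v.2 ^ 2) := by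
  have key : ∀ t : ℤ, (t = v.1 ∨ t = v.2 ∨ t = v.1 + v.2) →
      3 * t ^ 2 ≤ 4 * (v.1 ^ 2 + v.1 * v.2 + v.2 ^ 2) := by
    rintro t (rfl | rfl | rfl)
    · nlinarith [sq_nonneg (v.1 + 2 * v.2)]
    · nlinarith [sq_nonneg (2 * v.1 + v.2)]
    · nlinarith [sq_nonneg (v.1 - v.2)]
  -- the largest of `|a|, |b|, |a+b|`
  rcases le_or_gt |v.2| |v.1| with h12 | h12
  · rcases le_or_gt |v.1 + v.2| |v.1| with h13 | h13
    · refine ⟨(v.1).natAbs, ?_, ?_⟩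
      · simp only [hexLe, Int.natCast_natAbs]
        refine ⟨le_abs_self _, neg_le_abs _, ?_, ?_, ?_, ?_⟩ <;>
          linarith [le_abs_self v.2, neg_le_abs v.2, le_abs_self (v.1 + v.2),
            neg_le_abs (v.1 + v.2)]
      · rw [Int.natCast_natAbs, sq_abs]; exact key _ (Or.inl rfl)
    · refine ⟨(v.1 + v.2).natAbs, ?_, ?_⟩
      · simp only [hexLe, Int.natCast_natAbs]
        refine ⟨?_, ?_, ?_, ?_, le_abs_self _, neg_le_abs _⟩ <;>
          linarith [le_abs_self v.2, neg_le_abs v.2, le_abs_self v.1, neg_le_abs v.1]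
      · rw [Int.natCast_natAbs, sq_abs]; exact key _ (Or.inr (Or.inr rfl))
  · rcases le_or_gt |v.1 + v.2| |v.2| with h23 | h23
    · refine ⟨(v.2).natAbs, ?_, ?_⟩
      · simp only [hexLe, Int.natCast_natAbs]
        refine ⟨?_, ?_, le_abs_self _, neg_le_abs _, ?_, ?_⟩ <;>
          linarith [le_abs_self v.1, neg_le_abs v.1, le_abs_self (v.1 + v.2),
            neg_le_abs (v.1 + v.2)]
      · rw [Int.natCast_natAbs, sq_abs]; exact key _ (Or.inr (Or.inl rfl))
    · refine ⟨(v.1 + v.2).natAbs, ?_, ?_⟩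
      · simp only [hexLe, Int.natCast_natAbs]
        refine ⟨?_, ?_, ?_, ?_, le_abs_self _, neg_le_abs _⟩ <;>
          linarith [le_abs_self v.2, neg_le_abs v.2, le_abs_self v.1, neg_le_abs v.1]
      · rw [Int.natCast_natAbs, sq_abs]; exact key _ (Or.inr (Or.inr rfl))

end HexNorm

/-! ### Assembly: (61) in both directions for discrete imbeddings of defect-free discs -/

section Assembly

variable {X : Type*} {α : ℝ} {y : X → Plane} {ω : Set X} {Φ : X → ℤ × ℤ}

/-- The induction behind (62): a label at graph distance `≤ n` from `Φ(x)` is attained by a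
particle within `n(1 + α)` of `y(x)`, as long as `n(1 + α) < r` (the hexagons met on the way lie
in `B(y(x), r) ⊂ Ω′`, Remark 2.5). [cite: Theil2006, §4.2 Proposition 4.8 (3) (62)
(preprint p. 21); our induction] -/
private theorem exists_eq_of_hexLe (hΦ : IsDiscreteImbeddingOn α y ω Φ) (hα0 : 0 ≤ α)
    (hα : α < 1) {x : X}
    {r : ℝ} (hball : ∀ b, dist (y b) (y x) < r → b ∈ ω)
    (hdef : ∀ b, dist (y b) (y x) < r → b ∉ defectSet α y) :
    ∀ n : ℕ, (n : ℝ) * (1 + α) < r → ∀ g : ℤ × ℤ, hexLe (g - Φ x) n →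
      ∃ x'' : X, dist (y x'') (y x) ≤ n * (1 + α) ∧ Φ x'' = g := by
  intro n
  induction n with
  | zero =>
    intro _ g hg
    refine ⟨x, by simp, ?_⟩
    have := eq_zero_of_hexLe_zero hg
    rwa [sub_eq_zero, eq_comm] at this
  | succ n ih =>
    intro hr g hg
    have hr' : (n : ℝ) * (1 + α) < r := by
      refine lt_of_le_of_lt ?_ hr
      push_cast
      nlinarith
    rcases hexLe_step hg with h | ⟨u, hu, h⟩
    · obtain ⟨x'', hd, hx''⟩ := ih hr' g h
      exact ⟨x'', hd.trans (by push_cast; nlinarith), hx''⟩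
    · rw [sub_right_comm] at h
      obtain ⟨x', hd, hx'⟩ := ih hr' (g - u) h
      -- the hexagon of `x'` lies in the ball
      have hx'def : x' ∉ defectSet α y := hdef x' (lt_of_le_of_lt hd hr')
      have hN : nbhdSet α y x' ⊆ ω := by
        intro b hb
        rw [mem_nbhdSet_iff] at hb
        rcases hb with rfl | hb
        · exact hball _ (lt_of_le_of_lt hd hr')
        · refine hball b (lt_of_le_of_lt ?_ hr)
          calc dist (y b) (y x) ≤ dist (y b) (y x') + dist (y x') (y x) := dist_triangle _ _ _
            _ ≤ (1 + α) + n * (1 + α) := by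
                gcongr
                rw [dist_comm]; exact hb.dist_le
            _ = ((n + 1 : ℕ) : ℝ) * (1 + α) := by push_cast; ring
      have himg := hΦ.image_neighbours_eq hα hx'def hN
      have hg1 : g ∈ {k' : ℤ × ℤ | dist (triPoint (Φ x')) (triPoint k') = 1} := by
        show dist (triPoint (Φ x')) (triPoint g) = 1
        rw [hx', dist_triPoint, sub_sub_cancel_left, map_neg, norm_neg]
        exact norm_triPoint_of_mem_unitShell hu
      rw [← himg] at hg1
      obtain ⟨x'', hx''s, hx''g⟩ := hg1
      refine ⟨x'', ?_, hx''g⟩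
      calc dist (y x'') (y x) ≤ dist (y x'') (y x') + dist (y x') (y x) := dist_triangle _ _ _
        _ ≤ (1 + α) + n * (1 + α) := by
            gcongr
            rw [dist_comm]; exact IsShortRange.dist_le hx''s
        _ = ((n + 1 : ℕ) : ℝ) * (1 + α) := by push_cast; ring

/-- **(62) with the sharp Euclidean/graph conversion factor** (a private copy of
`IsDiscreteImbeddingOn.exists_eq_of_dist_lt_sharp` of `Theil2006ReferenceSurjectivity.lean`, kept
here so that this file does not depend on that module's rebuild): a label `g` with
`(2/√3)(1 + α)|g − Φ(x)| < r` is attained by a particle within `(2/√3)(1 + α)|g − Φ(x)|` of `y(x)`.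
[cite: Theil2006, §4.2 Proposition 4.8 (3) (62) (preprint p. 21); our bookkeeping] -/
private theorem realize_label (hΦ : IsDiscreteImbeddingOn α y ω Φ)
    (hα0 : 0 ≤ α) (hα : α < 1) {x : X} {r : ℝ} (hball : ∀ b, dist (y b) (y x) < r → b ∈ ω)
    (hdef : ∀ b, dist (y b) (y x) < r → b ∉ defectSet α y) {g : ℤ × ℤ}
    (hg : 2 / √3 * (1 + α) * dist (triPoint g) (triPoint (Φ x)) < r) :
    ∃ x'' : X, dist (y x'') (y x) ≤ 2 / √3 * (1 + α) * dist (triPoint g) (triPoint (Φ x)) ∧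
      Φ x'' = g := by
  obtain ⟨n, hn, hsq⟩ := exists_hexLe_sq_le (g - Φ x)
  have hd : dist (triPoint g) (triPoint (Φ x)) ^ 2 =
      (((g - Φ x).1 ^ 2 + (g - Φ x).1 * (g - Φ x).2 + (g - Φ x).2 ^ 2 : ℤ) : ℝ) := by
    rw [dist_triPoint, norm_triPoint_sq]
  have hsq' : 3 * (n : ℝ) ^ 2 ≤ 4 * dist (triPoint g) (triPoint (Φ x)) ^ 2 := by
    rw [hd]; exact_mod_cast hsq
  have h0 : 0 ≤ dist (triPoint g) (triPoint (Φ x)) := dist_nonneg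
  have h1 : 0 ≤ (n : ℝ) := Nat.cast_nonneg n
  have h3 : 0 < √3 := Real.sqrt_pos.2 (by norm_num)
  have h33 : (√3 : ℝ) ^ 2 = 3 := Real.sq_sqrt (by norm_num)
  have hn2 : (n : ℝ) ≤ 2 / √3 * dist (triPoint g) (triPoint (Φ x)) := by
    rw [div_mul_eq_mul_div, le_div_iff₀ h3]
    have h6 : ((n : ℝ) * √3) ^ 2 ≤ (2 * dist (triPoint g) (triPoint (Φ x))) ^ 2 := by
      rw [mul_pow, h33]; nlinarith
    exact (abs_le_of_sq_le_sq' h6 (by positivity)).2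
  have hn3 : (n : ℝ) * (1 + α) ≤ 2 / √3 * (1 + α) * dist (triPoint g) (triPoint (Φ x)) := by
    have h1α : 0 ≤ 1 + α := by linarith
    calc (n : ℝ) * (1 + α) ≤ 2 / √3 * dist (triPoint g) (triPoint (Φ x)) * (1 + α) :=
          mul_le_mul_of_nonneg_right hn2 h1α
      _ = 2 / √3 * (1 + α) * dist (triPoint g) (triPoint (Φ x)) := by ring
  have hnr : (n : ℝ) * (1 + α) < r := lt_of_le_of_lt hn3 hg
  obtain ⟨x'', hdist, hx''⟩ := exists_eq_of_hexLe hΦ hα0 hα hball hdef n hnr g hn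
  exact ⟨x'', hdist.trans hn3, hx''⟩

/-- A vertex of a unit lattice triangle is within `1` of every point of the closed triangle.
[folklore] -/
private theorem dist_vertex_le_one (hα0 : 0 ≤ α) (hα3 : α < √3 - 1) {T : Finset (ℤ × ℤ)}
    (hT : IsEquilateralSimplex α triPoint 1 T) {f : Plane} (hf : f ∈ convexHull ℝ (triPoint '' ↑T))
    {η : ℤ × ℤ} (hη : η ∈ T) : dist f (triPoint η) ≤ 1 := by
  have hTsr := (isEquilateralSimplex_one_iff.1 hT).2
  refine dist_le_of_mem_convexHull (fun Q hQ => ?_) hf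
  obtain ⟨η', hη', rfl⟩ := hQ
  by_cases hηη' : η' = η
  · rw [hηη', dist_self]; exact zero_le_one
  · exact (dist_triPoint_eq_one_of_isShortRange hα0 hα3 (hTsr η' hη' η hη hηη')).le

/-- **Realized triangles from the surjectivity (62).** Around a particle `z` whose disc
`B(y(z), ρ)` lies in the patch and is defect-free, every lattice triangle whose vertices `η`
satisfy `(2/√3)(1 + α)|η − Φ(z)| + (1 + α) < ρ` is realized: the vertex labels are attained
by particles `p` with `|y(p) − y(z)| ≤ (2/√3)(1 + α)|η − Φ(z)|` (`realize_label`),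
whose neighbourhoods then lie in the disc. [cite: Theil2006, §4.2 Proposition 4.8 (3) (62)
(preprint p. 21); our bookkeeping] -/
private theorem realized_of_near (hΦ : IsDiscreteImbeddingOn α y ω Φ) (hα0 : 0 ≤ α)
    (hα1 : α < 1) {z : X} {ρ : ℝ} (hball : ∀ b, dist (y b) (y z) < ρ → b ∈ ω)
    (hdef : ∀ b, dist (y b) (y z) < ρ → b ∉ defectSet α y) {T : Finset (ℤ × ℤ)}
    (hT : ∀ η ∈ T, 2 / √3 * (1 + α) * dist (triPoint η) (triPoint (Φ z)) + (1 + α) < ρ) :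
    Realized α y ω Φ T := by
  intro η hη
  have h1α : 0 < 1 + α := by linarith
  have hη' := hT η hη
  obtain ⟨p, hpd, hpη⟩ := realize_label hΦ hα0 hα1 hball hdef (g := η) (by linarith)
  have hpρ : dist (y p) (y z) < ρ - (1 + α) := by linarith
  refine ⟨p, hball p (by linarith), hpη, hdef p (by linarith), fun b hb => ?_⟩
  rw [mem_nbhdSet_iff] at hb
  rcases hb with rfl | hb
  · exact hball _ (by linarith)
  · refine hball b ?_
    calc dist (y b) (y z) ≤ dist (y b) (y p) + dist (y p) (y z) := dist_triangle _ _ _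
      _ < (1 + α) + (ρ - (1 + α)) := by
          refine add_lt_add_of_le_of_lt ?_ hpρ
          rw [dist_comm]; exact hb.dist_le
      _ = ρ := by ring

/-- `2/√3 ≤ 1.155`. [folklore] -/
private theorem two_div_sqrt_three_le : 2 / √3 ≤ 1155 / 1000 := by
  have h3 : 0 < √3 := Real.sqrt_pos.2 (by norm_num)
  have h : (17317 : ℝ) / 10000 < √3 := by
    rw [show (17317 : ℝ) / 10000 = √((17317 / 10000) ^ 2) by rw [Real.sqrt_sq (by norm_num)]]
    exact Real.sqrt_lt_sqrt (by norm_num) (by norm_num)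
  rw [div_le_iff₀ h3]
  nlinarith

/-- **(61) in both directions, explicit constants.** For a discrete imbedding `Φ` of
`ω ⊇ y⁻¹(B(c, R₁))`, no defect in `B(c, R₁)`, `(5/2)(r + 1) ≤ R₁`, `Kα ≤ 1/100`, and
`y(x), y(x′) ∈ B(c, r)`:
`|y(x) − y(x′)| ≤ (1 + Kα)|Φ(x) − Φ(x′)|` and `|Φ(x) − Φ(x′)| ≤ (1 − Kα)⁻¹|y(x) − y(x′)|`.
The radius bookkeeping: the upper bound needs the unit simplices within `r + 2` of `c`; the
lower bound realizes each half of the label segment (length `D ≤ (1 − Kα)⁻¹ · 2r`) from its own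
endpoint, which needs `(2/√3)(1 + α)(D/2 + 1) + (1 + α) < R₁ − r`.
[cite: Theil2006, §4.2 Proposition 4.8 (2) (61) (preprint pp. 21, 23); our proof] -/
private theorem rigidity_aux [Finite X] {K α₀ : ℝ} (hBL : SimplexBiLipschitz K α₀)
    (hΦ : IsDiscreteImbeddingOn α y ω Φ) (hα : 0 < α) (hα' : α ≤ 1 / 200) (hαα₀ : α ≤ α₀)
    (hKα : K * α ≤ 1 / 100) (hsep : ∀ x x' : X, x ≠ x' → 1 - α < dist (y x) (y x'))
    {c : Plane} {r R₁ : ℝ} (hR₁ : 5 / 2 * (r + 1) ≤ R₁)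
    (hω : ∀ z, y z ∈ ball c R₁ → z ∈ ω) (hdef : ∀ b ∈ defectSet α y, R₁ ≤ dist (y b) c)
    {x x' : X} (hx : y x ∈ ball c r) (hx' : y x' ∈ ball c r) :
    dist (y x) (y x') ≤ (1 + K * α) * dist (triPoint (Φ x)) (triPoint (Φ x')) ∧
      dist (triPoint (Φ x)) (triPoint (Φ x')) ≤ (1 - K * α)⁻¹ * dist (y x) (y x') := by
  have hα1 : α < 1 := by linarith
  have hα3 : α < √3 - 1 := lt_sqrt_three_sub_one hα'
  have hr0 : 0 < r := lt_of_le_of_lt dist_nonneg (mem_ball.1 hx)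
  have h1K : 0 < 1 - K * α := by linarith
  -- the upper bound
  have hup := dist_triPoint_le_aux hBL hα hα' hαα₀ (by linarith) hsep (R := R₁) (by linarith)
    hdef (fun a b c' ha hb hc' _ _ _ => ⟨ω, hΦ, hω a ha, hω b hb, hω c' hc'⟩) hx hx'
  refine ⟨?_, hup⟩
  -- bookkeeping for the lower bound
  have hxω : x ∈ ω := hω x (ball_subset_ball (by linarith) hx)
  have hx'ω : x' ∈ ω := hω x' (ball_subset_ball (by linarith) hx')
  set D : ℝ := dist (triPoint (Φ x)) (triPoint (Φ x')) with hD
  have hD0 : 0 ≤ D := dist_nonneg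
  have hdxx' : dist (y x) (y x') < 2 * r := by
    calc dist (y x) (y x') ≤ dist (y x) c + dist (y x') c := dist_triangle_right _ _ _
      _ < r + r := add_lt_add (mem_ball.1 hx) (mem_ball.1 hx')
      _ = 2 * r := by ring
  have hinv : (1 - K * α)⁻¹ ≤ 100 / 99 := by
    rw [show (100 : ℝ) / 99 = (99 / 100)⁻¹ by norm_num]
    exact inv_anti₀ (by norm_num) (by linarith)
  have hDr : D ≤ 100 / 99 * (2 * r) :=
    hup.trans (mul_le_mul hinv hdxx'.le dist_nonneg (by norm_num))
  have h23 := two_div_sqrt_three_le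
  have h23' : 0 ≤ 2 / √3 := by positivity
  have hkey : 2 / √3 * (1 + α) * (D / 2 + 1) + (1 + α) < R₁ - r := by
    have h1 : 2 / √3 * (1 + α) ≤ 1155 / 1000 * (201 / 200) :=
      mul_le_mul h23 (by linarith) (by linarith) (by norm_num)
    have h2 : 2 / √3 * (1 + α) * (D / 2 + 1) ≤ 1155 / 1000 * (201 / 200) * (D / 2 + 1) :=
      mul_le_mul_of_nonneg_right h1 (by linarith)
    nlinarith
  -- discs around `x` and `x'` inside the patch
  have hballz : ∀ z : X, y z ∈ ball c r → ∀ b, dist (y b) (y z) < R₁ - r → b ∈ ω := by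
    intro z hz b hb
    refine hω b (mem_ball.2 ?_)
    calc dist (y b) c ≤ dist (y b) (y z) + dist (y z) c := dist_triangle _ _ _
      _ < (R₁ - r) + r := add_lt_add hb (mem_ball.1 hz)
      _ = R₁ := by ring
  have hdefz : ∀ z : X, y z ∈ ball c r → ∀ b, dist (y b) (y z) < R₁ - r → b ∉ defectSet α y := by
    intro z hz b hb hbd
    have h1 := hdef b hbd
    have h2 : dist (y b) c < R₁ := by
      calc dist (y b) c ≤ dist (y b) (y z) + dist (y z) c := dist_triangle _ _ _
        _ < (R₁ - r) + r := add_lt_add hb (mem_ball.1 hz)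
        _ = R₁ := by ring
    linarith
  -- realizability of the unit triangles meeting the label segment
  refine dist_le_aux hBL hΦ hα hα' hαα₀ hxω hx'ω fun T hT1 ⟨f, hfT, hfseg⟩ => ?_
  rw [segment_eq_image'] at hfseg
  obtain ⟨u, hu, rfl⟩ := hfseg
  have hvert : ∀ η ∈ T, ∀ G : Plane,
      dist (triPoint η) G ≤ 1 + dist (triPoint (Φ x) + u • (triPoint (Φ x') - triPoint (Φ x))) G := by
    intro η hη G
    have h1 := dist_vertex_le_one hα.le hα3 hT1 hfT hη
    rw [dist_comm] at h1
    linarith [dist_triangle (triPoint η) (triPoint (Φ x) + u • (triPoint (Φ x') - triPoint (Φ x))) G]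
  by_cases hu2 : u ≤ 1 / 2
  · -- the first half is realized from `x`
    have hf0 : dist (triPoint (Φ x) + u • (triPoint (Φ x') - triPoint (Φ x))) (triPoint (Φ x)) ≤
        D / 2 := by
      rw [dist_eq_norm, add_sub_cancel_left, norm_smul, Real.norm_eq_abs, abs_of_nonneg hu.1,
        ← dist_eq_norm, dist_comm, ← hD]
      nlinarith
    refine realized_of_near hΦ hα.le hα1 (hballz x hx) (hdefz x hx) fun η hη => ?_
    have h1 : dist (triPoint η) (triPoint (Φ x)) ≤ D / 2 + 1 := by
      linarith [hvert η hη (triPoint (Φ x))]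
    have h2 : 2 / √3 * (1 + α) * dist (triPoint η) (triPoint (Φ x)) ≤
        2 / √3 * (1 + α) * (D / 2 + 1) :=
      mul_le_mul_of_nonneg_left h1 (by positivity)
    linarith
  · -- the second half is realized from `x'`
    push Not at hu2
    have hf1 : dist (triPoint (Φ x) + u • (triPoint (Φ x') - triPoint (Φ x))) (triPoint (Φ x')) ≤
        D / 2 := by
      have e : triPoint (Φ x) + u • (triPoint (Φ x') - triPoint (Φ x)) - triPoint (Φ x') =
          (1 - u) • (triPoint (Φ x) - triPoint (Φ x')) := by
        rw [sub_smul, one_smul, smul_sub, smul_sub]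
        abel
      rw [dist_eq_norm, e, norm_smul, Real.norm_eq_abs, abs_of_nonneg (by linarith [hu.2]),
        ← dist_eq_norm, ← hD]
      nlinarith
    refine realized_of_near hΦ hα.le hα1 (hballz x' hx') (hdefz x' hx') fun η hη => ?_
    have h1 : dist (triPoint η) (triPoint (Φ x')) ≤ D / 2 + 1 := by
      linarith [hvert η hη (triPoint (Φ x'))]
    have h2 : 2 / √3 * (1 + α) * dist (triPoint η) (triPoint (Φ x')) ≤
        2 / √3 * (1 + α) * (D / 2 + 1) :=
      mul_le_mul_of_nonneg_left h1 (by positivity)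
    linarith

end Assembly

/-! ### The theorems -/

section Main

/-- **Theil 2006, Proposition 4.8 (2): the rigidity estimate (61) holds for EVERY discrete
imbedding of a defect-free disc — proved, in two-sided form.** There are universal `K > 0`
and `α₁ > 0` such that for all `0 < α ≤ α₁`, every configuration `y` of finitely many
particles satisfying (13), every discrete imbedding `Φ` (Definition 2.4) of a patch
`ω ⊇ y⁻¹(B(c, R₁))` with no defect in `B(c, R₁)`, and all `x, x′` with
`y(x), y(x′) ∈ B(c, r)`, `(5/2)(r + 1) ≤ R₁`:
`(1 − Kα)|y(x) − y(x′)| ≤ |Φ(x) − Φ(x′)| ≤ (1 + Kα)|y(x) − y(x′)|`.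
The print states (61) for the imbedding it constructs and derives it from Lemma 4.2 and
Proposition 4.1 (F. John); this proof uses Lemma 4.2, (63), the embedded-complex structure of
the unit simplices and the surjectivity (62) instead (module docstring); the disc form and the
radius `(5/2)(r + 1)` are ours. [cite: Theil2006, §4.2 Proposition 4.8 (2) (61)
(preprint pp. 21, 23)] -/
theorem discreteImbedding_rigidity_ball :
    ∃ K α₁ : ℝ, 0 < K ∧ 0 < α₁ ∧
      ∀ {X : Type u} [Finite X] {α : ℝ} {y : X → Plane} {ω : Set X} {Φ : X → ℤ × ℤ},
        IsDiscreteImbeddingOn α y ω Φ → 0 < α → α ≤ α₁ →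
        (∀ x x' : X, x ≠ x' → 1 - α < dist (y x) (y x')) →
        ∀ {c : Plane} {r R₁ : ℝ}, 5 / 2 * (r + 1) ≤ R₁ → (∀ z, y z ∈ ball c R₁ → z ∈ ω) →
          (∀ b ∈ defectSet α y, R₁ ≤ dist (y b) c) →
          ∀ {x x' : X}, y x ∈ ball c r → y x' ∈ ball c r →
            (1 - K * α) * dist (y x) (y x') ≤ dist (triPoint (Φ x)) (triPoint (Φ x')) ∧
              dist (triPoint (Φ x)) (triPoint (Φ x')) ≤ (1 + K * α) * dist (y x) (y x') := by
  obtain ⟨K, α₀, hK, hα₀, hBL⟩ := exists_simplexBiLipschitz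
  refine ⟨2 * K, min α₀ (min (1 / 200) (1 / (100 * K))), by positivity,
    lt_min hα₀ (lt_min (by norm_num) (by positivity)), ?_⟩
  intro X _ α y ω Φ hΦ hα hα₁ hsep c r R₁ hR₁ hω hdef x x' hx hx'
  have hαα₀ : α ≤ α₀ := hα₁.trans (min_le_left _ _)
  have hα' : α ≤ 1 / 200 := hα₁.trans ((min_le_right _ _).trans (min_le_left _ _))
  have hαK : α ≤ 1 / (100 * K) := hα₁.trans ((min_le_right _ _).trans (min_le_right _ _))
  have hKα : K * α ≤ 1 / 100 := by
    rw [le_div_iff₀ (by positivity)] at hαK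
    linarith
  obtain ⟨hlo, hup⟩ := rigidity_aux hBL hΦ hα hα' hαα₀ hKα hsep hR₁ hω hdef hx hx'
  have hd0 : 0 ≤ dist (y x) (y x') := dist_nonneg
  have hD0 : 0 ≤ dist (triPoint (Φ x)) (triPoint (Φ x')) := dist_nonneg
  have hKα0 : 0 ≤ K * α := by positivity
  constructor
  · -- `d_y ≤ (1 + Kα) d_Φ` gives `(1 − 2Kα) d_y ≤ (1 − 2Kα)(1 + Kα) d_Φ ≤ d_Φ`
    have h1 : (1 - 2 * K * α) * dist (y x) (y x') ≤
        (1 - 2 * K * α) * ((1 + K * α) * dist (triPoint (Φ x)) (triPoint (Φ x'))) :=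
      mul_le_mul_of_nonneg_left hlo (by linarith)
    have h2 : (1 - 2 * K * α) * ((1 + K * α) * dist (triPoint (Φ x)) (triPoint (Φ x'))) ≤
        dist (triPoint (Φ x)) (triPoint (Φ x')) := by
      nlinarith [mul_nonneg hKα0 hD0, mul_nonneg (mul_nonneg hKα0 hKα0) hD0]
    exact h1.trans h2
  · -- `d_Φ ≤ (1 − Kα)⁻¹ d_y ≤ (1 + 2Kα) d_y`
    have h1K : 0 < 1 - K * α := by linarith
    have hinv : (1 - K * α)⁻¹ ≤ 1 + 2 * K * α := by
      rw [inv_le_iff_one_le_mul₀ h1K]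
      nlinarith
    calc dist (triPoint (Φ x)) (triPoint (Φ x')) ≤ (1 - K * α)⁻¹ * dist (y x) (y x') := hup
      _ ≤ (1 + 2 * K * α) * dist (y x) (y x') := mul_le_mul_of_nonneg_right hinv hd0

/-- **Theil 2006, Proposition 4.8 (2), (61) as printed (quotient form), for every discrete
imbedding of a defect-free disc — proved**: with `K, α₁` as in
`discreteImbedding_rigidity_ball`, `| |Φ(x) − Φ(x′)| / |y(x) − y(x′)| − 1 | ≤ Kα` for all
`x ≠ x′` of the disc. [cite: Theil2006, §4.2 Proposition 4.8 (2) (61) (preprint p. 21)] -/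
theorem discreteImbedding_rigidity_ball' :
    ∃ K α₁ : ℝ, 0 < K ∧ 0 < α₁ ∧
      ∀ {X : Type u} [Finite X] {α : ℝ} {y : X → Plane} {ω : Set X} {Φ : X → ℤ × ℤ},
        IsDiscreteImbeddingOn α y ω Φ → 0 < α → α ≤ α₁ →
        (∀ x x' : X, x ≠ x' → 1 - α < dist (y x) (y x')) →
        ∀ {c : Plane} {r R₁ : ℝ}, 5 / 2 * (r + 1) ≤ R₁ → (∀ z, y z ∈ ball c R₁ → z ∈ ω) →
          (∀ b ∈ defectSet α y, R₁ ≤ dist (y b) c) →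
          ∀ {x x' : X}, y x ∈ ball c r → y x' ∈ ball c r → x ≠ x' →
            |dist (triPoint (Φ x)) (triPoint (Φ x')) / dist (y x) (y x') - 1| ≤ K * α := by
  obtain ⟨K, α₁, hK, hα₁, h⟩ := discreteImbedding_rigidity_ball
  refine ⟨K, min α₁ 1, hK, lt_min hα₁ one_pos, ?_⟩
  intro X _ α y ω Φ hΦ hα hαle hsep c r R₁ hR₁ hω hdef x x' hx hx' hxx'
  have hα1 : α < 1 ∨ α = 1 := (hαle.trans (min_le_right _ _)).lt_or_eq
  have hd : 0 < dist (y x) (y x') := by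
    have := hsep x x' hxx'
    rcases hα1 with h1 | h1
    · linarith
    · exact lt_of_le_of_ne dist_nonneg fun h0 => by
        rw [← h0] at this; linarith [dist_nonneg (x := y x) (y := y x')]
  obtain ⟨hlo, hup⟩ := h hΦ hα (hαle.trans (min_le_left _ _)) hsep hR₁ hω hdef hx hx'
  rw [abs_le]
  constructor
  · rw [le_sub_iff_add_le, le_div_iff₀ hd]
    linarith
  · rw [sub_le_iff_le_add, div_le_iff₀ hd]
    linarith

/-- **What remains of Proposition 4.8 is bare existence.** If, for all small `α`, every
defect-free disc patch `y⁻¹(B(c, ρ))` (no defect within `ρ + 2` of `c`; (13); finitely many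
particles) admits SOME discrete imbedding, then discrete imbeddings with the rigidity estimate
(61) exist on all discs `B(c, r)`, `r ≥ 2`, whose defects are `≥ 4r + 2` away — the exact
hypothesis (H48′) under which `Theil2006FromReferences` derives Theorems 1.1, 1.2 and
Corollary 1.3 ((60) by `Theil2006ReferenceUniqueness`, (62) by `Theil2006ReferenceSurjectivity`).
Bookkeeping: take the imbedding of `y⁻¹(B(c, R − 2))` and apply (61) on `B(c, r)`,
`(5/2)(r + 1) ≤ 4r ≤ R − 2` for `r ≥ 2`. [cite: Theil2006, §4.2 Proposition 4.8 (preprint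
p. 21); our reduction] -/
theorem exists_rigid_of_exists_imbedding
    (hE : ∃ α₂ : ℝ, 0 < α₂ ∧ ∀ ⦃α : ℝ⦄, 0 < α → α < α₂ →
      ∀ {N : ℕ} (y : Fin N → Plane), (∀ i j : Fin N, i ≠ j → 1 - α < dist (y i) (y j)) →
      ∀ (c : Plane) (ρ : ℝ), 0 < ρ → (∀ b ∈ defects α y, ρ + 2 ≤ dist (y b) c) →
        ∃ Φ : Fin N → ℤ × ℤ, IsDiscreteImbeddingOn α y (y ⁻¹' ball c ρ) Φ) :
    ∃ α₀ K : ℝ, 0 < α₀ ∧ 0 ≤ K ∧ ∀ ⦃α : ℝ⦄, 0 < α → α < α₀ →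
      ∀ {N : ℕ} (y : Fin N → Plane), (∀ i j : Fin N, i ≠ j → 1 - α < dist (y i) (y j)) →
      ∀ (c : Plane) (r R : ℝ), 2 ≤ r → 4 * r + 2 ≤ R → (∀ b ∈ defects α y, R ≤ dist (y b) c) →
        ∃ Φ : Fin N → ℤ × ℤ, IsDiscreteImbeddingOn α y (y ⁻¹' ball c r) Φ ∧
          (∀ x x' : Fin N, y x ∈ ball c r → y x' ∈ ball c r → x ≠ x' →
            |dist (triPoint (Φ x)) (triPoint (Φ x')) / dist (y x) (y x') - 1| ≤ K * α) := by
  obtain ⟨α₂, hα₂, hE⟩ := hE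
  obtain ⟨K, α₁, hK, hα₁, h⟩ := discreteImbedding_rigidity_ball'
  refine ⟨min α₁ α₂, K, lt_min hα₁ hα₂, hK.le, ?_⟩
  intro α hα hαlt N y hsep c r R hr hR hdef
  have hαle : α ≤ α₁ := (hαlt.trans_le (min_le_left _ _)).le
  have hα2 : α < α₂ := hαlt.trans_le (min_le_right _ _)
  obtain ⟨Φ, hΦ⟩ := hE hα hα2 y hsep c (R - 2) (by linarith)
    (fun b hb => by have := hdef b hb; linarith)
  have hdef' : ∀ b ∈ defectSet α y, R - 2 ≤ dist (y b) c := fun b hb => by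
    have hb' : b ∈ defects α y := by rw [← Finset.mem_coe, coe_defects]; exact hb
    have := hdef b hb'
    linarith
  refine ⟨Φ, hΦ.mono (preimage_mono (ball_subset_ball (by linarith))), ?_⟩
  intro x x' hx hx' hxx'
  exact h hΦ hα hαle hsep (c := c) (r := r) (R₁ := R - 2) (by linarith) (fun z hz => hz) hdef'
    hx hx' hxx'

end Main


/-- **(61) in local form, both halves, one pair of constants** — the interface used for the
existence part of Proposition 4.8 (`Theil2006ExistsReference.lean`). UPPER: if every particle
of `B(c, R)` carries a discrete imbedding of its neighbourhood under `Φ` (local charts; no global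
injectivity), `r + 2 ≤ R` and no defect is within `R` of `c`, then
`|Φ(x) − Φ(x′)| ≤ (1 + Kα)|y(x) − y(x′)|` on `B(c, r)`. LOWER: if `Φ` is a discrete imbedding of
a patch `ω ∋ x, x′` and every unit lattice triangle meeting the label segment `[Φ(x), Φ(x′)]`
is realized by non-defective particles of `ω` whose neighbourhoods lie in `ω`, then
`|y(x) − y(x′)| ≤ (1 + Kα)|Φ(x) − Φ(x′)|`. (`0 < α ≤ α₁`, (13), finitely many particles.)
[cite: Theil2006, §4.2 Proposition 4.8 (2) (61) (preprint pp. 21, 23); our proof, without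
Proposition 4.1] -/
theorem chart_rigidity :
    ∃ K α₁ : ℝ, 0 < K ∧ 0 < α₁ ∧
      ∀ {X : Type u} [Finite X] {α : ℝ} {y : X → Plane} {Φ : X → ℤ × ℤ},
        0 < α → α ≤ α₁ → (∀ x x' : X, x ≠ x' → 1 - α < dist (y x) (y x')) →
        (∀ {c : Plane} {r R : ℝ}, r + 2 ≤ R → (∀ b ∈ defectSet α y, R ≤ dist (y b) c) →
          (∀ z, y z ∈ ball c R → IsDiscreteImbeddingOn α y (nbhdSet α y z) Φ) →
          ∀ {x x' : X}, y x ∈ ball c r → y x' ∈ ball c r →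
            dist (triPoint (Φ x)) (triPoint (Φ x')) ≤ (1 + K * α) * dist (y x) (y x')) ∧
        (∀ {ω : Set X} {x x' : X}, IsDiscreteImbeddingOn α y ω Φ → x ∈ ω → x' ∈ ω →
          (∀ T : Finset (ℤ × ℤ), IsEquilateralSimplex α (triPoint : ℤ × ℤ → Plane) 1 T →
            (∃ f ∈ convexHull ℝ (triPoint '' (↑T : Set (ℤ × ℤ))),
              f ∈ segment ℝ (triPoint (Φ x)) (triPoint (Φ x'))) →
            ∀ η ∈ T, ∃ p ∈ ω, Φ p = η ∧ p ∉ defectSet α y ∧ nbhdSet α y p ⊆ ω) →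
          dist (y x) (y x') ≤ (1 + K * α) * dist (triPoint (Φ x)) (triPoint (Φ x'))) := by
  obtain ⟨K, α₀, hK, hα₀, hBL⟩ := exists_simplexBiLipschitz
  refine ⟨2 * K, min α₀ (min (1 / 200) (1 / (100 * K))), by positivity,
    lt_min hα₀ (lt_min (by norm_num) (by positivity)), ?_⟩
  intro X _ α y Φ hα hα₁ hsep
  have hαα₀ : α ≤ α₀ := hα₁.trans (min_le_left _ _)
  have hα' : α ≤ 1 / 200 := hα₁.trans ((min_le_right _ _).trans (min_le_left _ _))
  have hαK : α ≤ 1 / (100 * K) := hα₁.trans ((min_le_right _ _).trans (min_le_right _ _))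
  have hKα : K * α ≤ 1 / 100 := by
    rw [le_div_iff₀ (by positivity)] at hαK
    linarith
  have hKα0 : 0 ≤ K * α := by positivity
  constructor
  · intro c r R hrR hdef hch x x' hx hx'
    have hup := dist_triPoint_le_aux hBL hα hα' hαα₀ (by linarith) hsep hrR hdef
      (fun a b c' ha _ _ sab sac _ =>
        ⟨nbhdSet α y a, hch a ha, mem_nbhdSet_self a, sab.mem_nbhdSet, sac.mem_nbhdSet⟩) hx hx'
    have hd0 : 0 ≤ dist (y x) (y x') := dist_nonneg
    have h1K : 0 < 1 - K * α := by linarith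
    have hinv : (1 - K * α)⁻¹ ≤ 1 + 2 * K * α := by
      rw [inv_le_iff_one_le_mul₀ h1K]
      nlinarith
    calc dist (triPoint (Φ x)) (triPoint (Φ x')) ≤ (1 - K * α)⁻¹ * dist (y x) (y x') := hup
      _ ≤ (1 + 2 * K * α) * dist (y x) (y x') := mul_le_mul_of_nonneg_right hinv hd0
  · intro ω x x' hΦ hx hx' hreal
    have hlo := dist_le_aux hBL hΦ hα hα' hαα₀ hx hx' hreal
    have hD0 : 0 ≤ dist (triPoint (Φ x)) (triPoint (Φ x')) := dist_nonneg
    calc dist (y x) (y x') ≤ (1 + K * α) * dist (triPoint (Φ x)) (triPoint (Φ x')) := hlo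
      _ ≤ (1 + 2 * K * α) * dist (triPoint (Φ x)) (triPoint (Φ x')) := by
          apply mul_le_mul_of_nonneg_right _ hD0; linarith

end Theil2006

end Literature.MathematicalPhysics.StatisticalMechanics

end
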